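import Literature.NumberTheory.Sieve.FriedlanderIwaniecPrimesLocalDensity
import Literature.NumberTheory.Sieve.FriedlanderIwaniecPrimesMainTerm
import Literature.NumberTheory.Sieve.FriedlanderIwaniecPrimesAssembly
import Literature.NumberTheory.Sieve.FriedlanderIwaniecPrimesProp21
import Literature.NumberTheory.Sieve.CoprimeSquarefreeSums
import HarnessLib

/-!
# Friedlander–Iwaniec, *The polynomial `X² + Y⁴` captures its primes*: Lemma 3.4 and Proposition 3.5 from Lemma 3.1 (proofs)

Family `parity`, statement parity.S17. Source: J. Friedlander, H. Iwaniec, Ann. of Math. (2) 148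
(1998), 945–1040 [FriedlanderIwaniecAnnals1998] (= arXiv:math/9811185), §3: the displays
defining `A_d(x)`, `M_d(x)`, `ρ(b; d)` after (3.1), (3.2), Lemma 3.1 (3.3), (3.14), Lemma 3.4
(3.15)–(3.16), (3.17)–(3.18), Proposition 3.5 (3.19).

This file proves theorems only (no new definitions, no new named facts). Its end result is

* `Literature.Parity.FriedlanderIwaniec1998_prop35_of_lemma31 :
    FriedlanderIwaniec1998_lemma31 → FriedlanderIwaniec1998_prop35`,

i.e. FI's deduction "thus for `d` cubefree the error term satisfies
`r_d(x) = A_d(x) - M_d(x) + O(h(d) x^{1/2})` ... This together with Lemma 3.1 implies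
Proposition 3.5" (the paragraph between (3.18) and (3.19)). After it, the level-of-distribution
input (2.9) of Theorem 1 (`FriedlanderIwaniec1998_prop35`, consumed by
`hyp29_of_prop35` / `friedlanderIwaniecSum_isEquivalent_of_inputs` and the squarefree assembly of
`FriedlanderIwaniecPrimesSquarefreeProofs` / `FriedlanderIwaniecPrimesAssembly`) rests on the
single harmonic-analysis fact `FriedlanderIwaniec1998_lemma31` (FI Lemma 3.1 = a modification of
Fouvry–Iwaniec's Lemma 4, proved in FI §3 by Poisson summation and the large sieve for the roots of
`ν² + 1 ≡ 0 (mod d)`), vendored in `FriedlanderIwaniecPrimesMainTerm`.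

## The argument

Throughout `d ≥ 1` is cubefree, `x ≥ 1`, `X = ⌊x⌋`, `ρ(c) = ρ(c²; d) = N(d, -c⁴)`
(`sqCongrCount d (-c⁴)`), `r = ∏_{p ∣ d} p` the radical of `d`, `τ = τ(d)`, and
`S(d) = Σ_{g ∣ d, g² ∣ d} g` (for `d = d₁d₂²` with `d₁d₂` squarefree this is `σ(d₂) ≤ τ(d) d₂`).

1. *Local structure of `ρ(c²; d)`* (exact CRT `sqCongrCount_mul`; `ρ(c²; p) = 1` or `ρ(p)` and
   `ρ(c²; p²) = p` or `ρ(p²)` according as `p ∣ c` or not, from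
   `FriedlanderIwaniecPrimesLocalDensity`): `c ↦ ρ(c²; d)` depends only on `gcd(c, r)`
   (`sqCongrCount_neg_pow_four_eq_gcd`), is `r`-periodic, has mean `ν(d)/d` over a period
   (`sum_divisors_sqCongrCount_mul_totient`: `Σ_{e ∣ r} ρ(e²; d) φ(r/e) = (r/d) ν(d)`, with
   `ν(d) = #{(α, c) mod d : α² + c⁴ ≡ 0} = g(d) d²`, `fiNu_eq_fiDensity_mul_sq`), and is bounded by
   `τ² S(d)` (`sqCongrCount_cubefree_le` of `FriedlanderIwaniecPrimesCrudeBound`). (FI use instead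
   the closed formula `ρ(ℓ²; d) = (ℓ, d₂) ρ(d₁d₂/(ℓ, d₁d₂))`, (3.2) and the display after (3.16).)
2. *Slices* (`mul_fiMainTerm_eq`, `abs_sum_sqCongrCount_card_sub_le`, tree `abs_card_slice_sub_le`):
   `d M_d(x) = Σ_{|c| ≤ X} ρ(c) #{a : a² + c⁴ ≤ X} - ρ(0) = 2 Σ_{|c| ≤ X} ρ(c) √(x - c⁴) + O(τ² S √x)`
   — FI's "`M_d(x) = (2/d) Σ_{|c| ≤ x^{1/4}} ρ(c²; d){(x - c⁴)^{1/2} + O(1)}`".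
3. *Progressions* (`abs_sum_fiSlice_mul_sub_le`, monotone comparison with the integral
   `∫₀^∞ √(x - t⁴)⁺ dt = κ x^{3/4}`, tree `integral_fiSlice`): `Σ_{k ≥ 1} √(x - (kq)⁴) = κ x^{3/4}/q + O(√x)`
   with an absolute `O`, no factor `q` — FI's "`φ(·) 2κx^{3/4}/(d₁d₂) + O(τ(·) x^{1/2})`".
4. *Möbius over the gcd classes* (`sum_filter_gcd_eq_eq_sum_moebius`, `Σ_{m ∣ n} μ(m)/m = φ(n)/n`
   from `CoprimeSquarefreeSums`) and 1.: `Σ_{1 ≤ c ≤ X} ρ(c) √(x - c⁴) = κ x^{3/4} ν(d)/d + O(τ² · τ²S · √x)`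
   (`abs_sum_Icc_sqCongrCount_fiSlice_sub_le`), whence **Lemma 3.4** in the explicit form
   `|M_d(x) - 4κ g(d) x^{3/4}| ≤ 16 τ(d)⁴ S(d) √x / d` (`abs_fiMainTerm_sub_le`). As recorded in
   `FriedlanderIwaniecPrimesMainTerm`, the display (3.15) prints `g(d) κ x^{3/4}`, without the
   factor `4` that (3.18) (`A(x) = 4κx^{3/4} + O(x^{1/2})`, "by Lemma 3.4 for `d = 1`") requires;
   here `g = fiDensity` is FI's (3.16) (so that `g(1) = 1`, `M_1 = A`) and the constant is `4κ`.
   FI's multiplicative majorant `h(d)` of (3.16) is replaced by `16 τ(d)⁴ S(d)/d`; both have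
   summatory function `(log D)^{O(1)}` over cubefree `d ≤ D`.
5. *Summation over `d ≤ D`* (`sum_card_divisors_pow_mul_sum_sq_dvd_div_le`): by the divisor bound
   (`Literature.NumberTheory.Sieve.exists_card_divisors_le_mul_rpow`, Hardy–Wright Thm 315) and
   `Σ_{d ≤ D} S(d)/d ≤ (Σ_{m ≤ D} 1/m)² ≤ (1 + log D)²`, `Σ_{d ≤ D} τ(d)⁴ S(d)/d ≪ D^{1/8}` — in place
   of FI's `Σ³_{d ≤ x} h(d) ≪ (log x)⁴`; any bound `≪ D^{1/4}` suffices for (3.19).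
6. *Proposition 3.5* (`FriedlanderIwaniec1998_prop35_of_lemma31`): for `1 ≤ t ≤ x`,
   `r_d(t) = (A_d(t) - M_d(t)) + (M_d(t) - 4κ g(d) t^{3/4}) - g(d)(A(t) - 4κ t^{3/4})`, summed over
   cubefree `d ≤ D` using Lemma 3.1 (the named fact), 4.–5., (3.18) (tree `abs_fiCount_sub_le`)
   and `g(d) ≤ τ² S(d)/d` (`fiDensity_le_of_isCubefree`); for `t < 1` all terms vanish.

## Contents (main statements)

* `sqCongrCount_mul` (exact CRT), `sqCongrCount_prime_neg_pow_four`,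
  `sqCongrCount_prime_sq_neg_pow_four`, `sqCongrCount_neg_pow_four_congr`,
  `sum_divisors_sqCongrCount_mul_totient`, `sum_range_sqCongrCount_eq_fiNu`
  (the bridge `ν(d) = Σ_{c mod d} ρ(c²; d)` asked for in the review of `…LocalDensity`);
* `abs_sum_fiSlice_mul_sub_le`, `sum_filter_gcd_eq_eq_sum_moebius`, `mul_fiMainTerm_eq`;
* `abs_fiMainTerm_sub_le` (Lemma 3.4), `fiDensity_le_of_isCubefree`,
  `sum_card_divisors_pow_mul_sum_sq_dvd_div_le`;
* `FriedlanderIwaniec1998_prop35_of_lemma31` (Proposition 3.5 ⇐ Lemma 3.1);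
* corollaries: parity.S17 (`friedlanderIwaniecSum_isEquivalent`, `setOf_prime_sq_add_pow_four_infinite`)
  from `FriedlanderIwaniec1998_prop21` (or `_prop21_consumed`), `_lemma31`, `_prop41` and
  `siegel_walfisz` (`…_of_lemma31_inputs_of_siegelWalfisz`, `…_of_consumedInputs_of_lemma31`).

## References

* J. Friedlander, H. Iwaniec, *The polynomial `X² + Y⁴` captures its primes*, Ann. of Math. (2)
  148 (1998), 945–1040, §3. [cite: FriedlanderIwaniecAnnals1998, §3, Lemma 3.4 (3.15)-(3.16), Proposition 3.5 (3.19)]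
* G. H. Hardy, E. M. Wright, *An Introduction to the Theory of Numbers*, 6th ed., OUP 2008,
  Thm 315 (the divisor bound, via `Literature/NumberTheory/Sieve/DivisorBound`).

## Mathlib / tree

Tree: `fiMainTerm`, `FriedlanderIwaniec1998_lemma31` (`…MainTerm`); `fiNu`, `fiNu_eq_fiDensity_mul_sq`,
`fiRho_prime_sq`, `card_filter_sq_add_pow_four_of_dvd/_of_not_dvd`, `fiNu_eq_sum` (`…LocalDensity`);
`sqCongrCount`, `sqCongrCount_cubefree_le`, `nat_sqrt_floor_le_sqrt`, `one_le_card_divisors`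
(`…CrudeBound`); `fiPoints`, `fiDisc`, `fiSlice`, `fiSlice_antitoneOn`, `integral_fiSlice`,
`abs_card_slice_sub_le`, `card_filter_pow_four_le`, `sum_Icc_neg_filter_ne_zero`,
`sum_Icc_int_eq_sum_Icc_nat`, `abs_fiCount_sub_le`, `fiSieveSeq_remainder`,
`FriedlanderIwaniec1998_prop35` (`FriedlanderIwaniecPrimes`); `Literature.NumberTheory.Sieve.SquarefreeSums.sum_divisors_moebius_div`
(`CoprimeSquarefreeSums`); `Literature.NumberTheory.Sieve.exists_card_divisors_le_mul_rpow` (`DivisorBound`). Mathlib: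
`ZMod.chineseRemainder`, `AntitoneOn.integral_le_sum`/`sum_le_integral`,
`intervalIntegral.integral_comp_mul_left`, `Nat.totient_div_of_dvd`, `ArithmeticFunction.coe_moebius_mul_coe_zeta`,
`harmonic_le_one_add_log`, `Real.log_le_rpow_div`. (The identity `Σ_{d ∣ n} μ(d) = [n = 1]`,
`Literature.NumberTheory.Sieve.sum_divisors_moebius_real` of `SieveFrameworkProofs` / `Literature.NumberTheory.Sieve.sum_divisors_moebius_eq_ite` of
`AsymptoticSieveForPrimesT`, neither in this file's import closure, is re-derived inline from
Mathlib's `coe_moebius_mul_coe_zeta` where used.)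
-/

noncomputable section

open Finset

namespace Literature.NumberTheory.Sieve.FriedlanderIwaniecPrimes

open scoped ArithmeticFunction.Moebius

/-! ### `ρ(c²; d) = N(d, -c⁴)`: exact multiplicativity and local values -/

/-- Bridge to natural-number divisibility: `N(d, -c⁴) = #{α mod d : d ∣ α² + c⁴}`. [folklore] -/
theorem sqCongrCount_neg_pow_four (d c : ℕ) :
    sqCongrCount d (-(c : ℤ) ^ 4) = #{α ∈ range d | d ∣ α ^ 2 + c ^ 4} := by
  unfold sqCongrCount
  congr 1
  ext α
  simp only [mem_filter, sub_neg_eq_add]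
  exact and_congr_right fun _ => by exact_mod_cast (Int.natCast_dvd_natCast (m := d) (n := α ^ 2 + c ^ 4))

/-- `N(d, t)` only depends on `t mod d`. [folklore] -/
theorem sqCongrCount_congr {d : ℕ} {t t' : ℤ} (h : (d : ℤ) ∣ t - t') : sqCongrCount d t = sqCongrCount d t' := by
  unfold sqCongrCount
  congr 1
  ext ν
  simp only [mem_filter]
  refine and_congr_right fun _ => ?_
  constructor
  · intro h1; have := h1.add h; rwa [show (ν : ℤ) ^ 2 - t + (t - t') = (ν : ℤ) ^ 2 - t' by ring] at this
  · intro h1; have := h1.sub h; rwa [show (ν : ℤ) ^ 2 - t' - (t - t') = (ν : ℤ) ^ 2 - t by ring] at this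

/-- `N(d, t)` counted in `ZMod d`. [folklore] -/
theorem sqCongrCount_eq_card_zmod (d : ℕ) [NeZero d] (t : ℤ) :
    sqCongrCount d t = #{ν : ZMod d | ν ^ 2 = (t : ZMod d)} := by
  unfold sqCongrCount
  refine Finset.card_bij (fun ν _ => (ν : ZMod d)) ?_ ?_ ?_
  · intro ν hν
    obtain ⟨-, hdvd⟩ := mem_filter.mp hν
    refine mem_filter.mpr ⟨mem_univ _, ?_⟩
    have h := (ZMod.intCast_zmod_eq_zero_iff_dvd ((ν : ℤ) ^ 2 - t) d).mpr hdvd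
    push_cast at h
    exact sub_eq_zero.mp h
  · intro ν hν ν' hν' h
    have hν1 := mem_range.mp (mem_filter.mp hν).1
    have hν2 := mem_range.mp (mem_filter.mp hν').1
    have h' := (ZMod.natCast_eq_natCast_iff' ν ν' d).mp h
    rwa [Nat.mod_eq_of_lt hν1, Nat.mod_eq_of_lt hν2] at h'
  · intro a ha
    refine ⟨a.val, mem_filter.mpr ⟨mem_range.mpr (ZMod.val_lt a), ?_⟩, ZMod.natCast_zmod_val a⟩
    have h := (mem_filter.mp ha).2
    refine (ZMod.intCast_zmod_eq_zero_iff_dvd _ _).mp ?_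
    push_cast
    rw [ZMod.natCast_zmod_val, h, sub_self]

/-- **Exact multiplicativity of `N(·, t)`** (Chinese remainder theorem). [folklore] -/
theorem sqCongrCount_mul {m n : ℕ} (hm : 0 < m) (hn : 0 < n) (hmn : m.Coprime n) (t : ℤ) :
    sqCongrCount (m * n) t = sqCongrCount m t * sqCongrCount n t := by
  haveI : NeZero m := ⟨hm.ne'⟩
  haveI : NeZero n := ⟨hn.ne'⟩
  haveI : NeZero (m * n) := ⟨(Nat.mul_pos hm hn).ne'⟩
  rw [sqCongrCount_eq_card_zmod, sqCongrCount_eq_card_zmod, sqCongrCount_eq_card_zmod,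
    ← Fintype.card_subtype, ← Fintype.card_subtype, ← Fintype.card_subtype, ← Fintype.card_prod]
  set e := ZMod.chineseRemainder hmn with he
  have het : e (t : ZMod (m * n)) = ((t : ZMod m), (t : ZMod n)) := by
    rw [map_intCast]; rfl
  have key : ∀ ν : ZMod (m * n), ν ^ 2 = (t : ZMod (m * n)) ↔
      ((e ν).1 ^ 2 = (t : ZMod m) ∧ (e ν).2 ^ 2 = (t : ZMod n)) := by
    intro ν
    constructor
    · intro h
      have := congrArg e h
      rw [map_pow, het, Prod.ext_iff] at this
      exact this
    · rintro ⟨h1, h2⟩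
      apply e.injective
      rw [map_pow, het, Prod.ext_iff]
      exact ⟨h1, h2⟩
  refine Fintype.card_congr
    { toFun := fun x => (⟨(e x.1).1, ((key _).mp x.2).1⟩, ⟨(e x.1).2, ((key _).mp x.2).2⟩)
      invFun := fun yz => ⟨e.symm (yz.1.1, yz.2.1), by
        rw [key]; simp only [RingEquiv.apply_symm_apply]; exact ⟨yz.1.2, yz.2.2⟩⟩
      left_inv := fun x => by
        apply Subtype.ext
        simp
      right_inv := fun yz => by
        obtain ⟨⟨a, ha⟩, ⟨b, hb⟩⟩ := yz
        simp }

/-! ### Local values -/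

/-- At a prime `p`: `ρ(c²; p) = 1` if `p ∣ c` (only `α = 0`), and `= ρ(p)` otherwise
(`α ↦ α c⁻²`). [folklore] -/
theorem sqCongrCount_prime_neg_pow_four {p : ℕ} (hp : p.Prime) (c : ℕ) :
    sqCongrCount p (-(c : ℤ) ^ 4) = if p ∣ c then 1 else fiRho p := by
  haveI : Fact p.Prime := ⟨hp⟩
  haveI : NeZero p := ⟨hp.ne_zero⟩
  split_ifs with hpc
  · rw [sqCongrCount_neg_pow_four]
    have hc4 : p ∣ c ^ 4 := dvd_pow hpc (by norm_num)
    rw [Finset.filter_congr (fun α _ => show p ∣ α ^ 2 + c ^ 4 ↔ p ∣ α by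
      rw [Nat.dvd_add_left hc4]; exact ⟨hp.dvd_of_dvd_pow, fun h => dvd_pow h two_ne_zero⟩)]
    rw [Finset.card_eq_one]
    refine ⟨0, ?_⟩
    ext α
    simp only [mem_filter, mem_range, mem_singleton]
    constructor
    · rintro ⟨hα, ⟨k, rfl⟩⟩
      rcases Nat.eq_zero_or_pos k with rfl | hk
      · simp
      · exfalso; have : p * 1 ≤ p * k := Nat.mul_le_mul_left p hk; omega
    · rintro rfl; exact ⟨hp.pos, dvd_zero p⟩
  · rw [← sqCongrCount_neg_one, sqCongrCount_eq_card_zmod, sqCongrCount_eq_card_zmod]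
    have hc0 : (c : ZMod p) ≠ 0 := by
      rw [Ne, ZMod.natCast_eq_zero_iff]; exact hpc
    have hc2 : (c : ZMod p) ^ 2 ≠ 0 := pow_ne_zero 2 hc0
    push_cast
    refine Finset.card_bij (fun α _ => α * ((c : ZMod p) ^ 2)⁻¹) ?_ ?_ ?_
    · intro α hα
      simp only [mem_filter, mem_univ, true_and] at hα ⊢
      have : (α * ((c : ZMod p) ^ 2)⁻¹) ^ 2 = α ^ 2 * (((c : ZMod p) ^ 2)⁻¹) ^ 2 := by ring
      rw [this, hα]
      field_simp
    · intro α _ α' _ h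
      simpa [mul_eq_mul_right_iff, inv_eq_zero, hc2] using h
    · intro β hβ
      refine ⟨β * (c : ZMod p) ^ 2, ?_, by field_simp⟩
      simp only [mem_filter, mem_univ, true_and] at hβ ⊢
      have : (β * (c : ZMod p) ^ 2) ^ 2 = β ^ 2 * (c : ZMod p) ^ 4 := by ring
      rw [this, hβ]; ring


/-! ### `ρ(c²; d)` depends only on `gcd(c, rad d)` -/

/-- At `p²`: `ρ(c²; p²) = p` if `p ∣ c` and `= ρ(p²)` otherwise. [folklore] -/
theorem sqCongrCount_prime_sq_neg_pow_four {p : ℕ} (hp : p.Prime) (c : ℕ) :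
    sqCongrCount (p ^ 2) (-(c : ℤ) ^ 4) = if p ∣ c then p else fiRho (p ^ 2) := by
  rw [sqCongrCount_neg_pow_four]
  split_ifs with hpc
  · exact card_filter_sq_add_pow_four_of_dvd hp hpc
  · exact card_filter_sq_add_pow_four_of_not_dvd hp hpc

/-- **`ρ(c²; d)` depends only on the set of primes of `d` dividing `c`** (cubefree `d`): if
`p ∣ c ↔ p ∣ c'` for every prime `p ∣ d`, then `ρ(c²; d) = ρ(c'²; d)`. [folklore] -/
theorem sqCongrCount_neg_pow_four_congr (c c' : ℕ) :
    ∀ d : ℕ, d ≠ 0 → IsCubefree d → (∀ p ∈ d.primeFactors, (p ∣ c ↔ p ∣ c')) →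
      sqCongrCount d (-(c : ℤ) ^ 4) = sqCongrCount d (-(c' : ℤ) ^ 4) := by
  intro d
  induction d using Nat.recOnPosPrimePosCoprime with
  | zero => intro h; exact absurd rfl h
  | one => intros; simp [sqCongrCount]
  | prime_pow p k hp hk =>
    intro _ hcf hpr
    have hmem : p ∈ (p ^ k).primeFactors := by
      rw [Nat.primeFactors_prime_pow hk.ne' hp]; exact mem_singleton_self p
    have hk2 : k ≤ 2 := by
      have := hcf p hmem
      rwa [hp.factorization_pow, Finsupp.single_eq_same] at this
    have hpc : (p ∣ c ↔ p ∣ c') := hpr p hmem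
    interval_cases k
    · rw [pow_one, sqCongrCount_prime_neg_pow_four hp, sqCongrCount_prime_neg_pow_four hp]
      simp only [hpc]
    · rw [sqCongrCount_prime_sq_neg_pow_four hp, sqCongrCount_prime_sq_neg_pow_four hp]
      simp only [hpc]
  | coprime a b ha hb hab iha ihb =>
    intro _ hcf hpr
    have ha0 : a ≠ 0 := by omega
    have hb0 : b ≠ 0 := by omega
    have hpa : ∀ p ∈ a.primeFactors, (p ∣ c ↔ p ∣ c') := fun p hp =>
      hpr p (by rw [Nat.primeFactors_mul ha0 hb0]; exact mem_union_left _ hp)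
    have hpb : ∀ p ∈ b.primeFactors, (p ∣ c ↔ p ∣ c') := fun p hp =>
      hpr p (by rw [Nat.primeFactors_mul ha0 hb0]; exact mem_union_right _ hp)
    rw [sqCongrCount_mul (by omega) (by omega) hab, sqCongrCount_mul (by omega) (by omega) hab,
      iha ha0 (hcf.of_mul_left hb0) hpa, ihb hb0 (hcf.of_mul_right ha0) hpb]


/-! ### gcd classes, Möbius inversion, and the mean of `ρ(c²; d)` -/

/-- `#{c mod r : gcd(c, r) = e} = φ(r/e)` for `e ∣ r`: Mathlib's `Nat.totient_div_of_dvd`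
(`φ(n/d) = #{k < n : gcd(n, k) = d}`) up to `gcd_comm`. [folklore] -/
private theorem card_range_filter_gcd_eq {r e : ℕ} (he : e ∣ r) :
    #{c ∈ range r | Nat.gcd c r = e} = Nat.totient (r / e) := by
  rw [Nat.totient_div_of_dvd he]
  simp_rw [Nat.gcd_comm]


/-! ### Progression sums of `√(x - t⁴)` -/

/-- **Progression sums of the slice function**: for `x ≥ 1` and `q ≥ 1`,
`|Σ_{k ≥ 1} √(x - (kq)⁴) - κ x^{3/4}/q| ≤ √x` (sum over `1 ≤ k ≤ ⌊x⌋`, all further terms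
vanish): the error of a progression sum is `O(√x)`, with no factor `q`. [folklore] -/
theorem abs_sum_fiSlice_mul_sub_le {x : ℝ} (hx : 1 ≤ x) {q : ℕ} (hq : 1 ≤ q) :
    |∑ k ∈ Icc 1 ⌊x⌋₊, fiSlice x ((k * q : ℕ) : ℝ) - friedlanderIwaniecKappa * x ^ (3 / 4 : ℝ) / q| ≤
      Real.sqrt x := by
  have hx0 : 0 < x := by linarith
  have hq0 : (0 : ℝ) < q := by exact_mod_cast hq
  set N := ⌊x⌋₊ with hN
  set g : ℝ → ℝ := fun u => fiSlice x (q * u) with hg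
  have hanti : AntitoneOn g (Set.Icc (0 : ℝ) (0 + (N + 1 : ℕ))) := by
    intro s hs t ht hst
    exact fiSlice_antitoneOn x (Set.mem_Ici.mpr (by have := hs.1; positivity))
      (Set.mem_Ici.mpr (by have := ht.1; positivity)) (mul_le_mul_of_nonneg_left hst hq0.le)
  have hlow := hanti.sum_le_integral
  have hup := hanti.integral_le_sum
  simp only [zero_add] at hlow hup
  -- the integral: `∫₀^{N+1} g = (1/q) ∫₀^{q(N+1)} √(x - t⁴) dt = κ x^{3/4} / q`
  have hint : ∫ u in (0 : ℝ)..(N + 1 : ℕ), g u = friedlanderIwaniecKappa * x ^ (3 / 4 : ℝ) / q := by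
    have h1 : ∫ u in (0 : ℝ)..(N + 1 : ℕ), g u = (q : ℝ)⁻¹ * ∫ t in ((q : ℝ) * 0)..((q : ℝ) * (N + 1 : ℕ)), fiSlice x t := by
      rw [hg, ← smul_eq_mul]
      exact intervalIntegral.integral_comp_mul_left (fiSlice x) hq0.ne'
    rw [h1, mul_zero, integral_fiSlice hx0]
    · field_simp
    · -- `x^{1/4} ≤ x ≤ N + 1 ≤ q (N + 1)`
      have h2 : x ^ (1 / 4 : ℝ) ≤ x := Real.rpow_le_self_of_one_le hx (by norm_num)
      have h3 : x ≤ ((N + 1 : ℕ) : ℝ) := by push_cast; exact (Nat.lt_floor_add_one x).le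
      have h4 : ((N + 1 : ℕ) : ℝ) ≤ q * ((N + 1 : ℕ) : ℝ) := le_mul_of_one_le_left (by positivity) (by exact_mod_cast hq)
      linarith
  -- `g(N + 1) = 0`
  have hzero : g ((N + 1 : ℕ) : ℝ) = 0 := by
    refine fiSlice_eq_zero ?_
    have h1 : x < (N + 1 : ℕ) := by push_cast; exact Nat.lt_floor_add_one x
    have h2 : (1 : ℝ) ≤ (N + 1 : ℕ) := by exact_mod_cast Nat.le_add_left 1 N
    have h3 : ((N + 1 : ℕ) : ℝ) ≤ q * ((N + 1 : ℕ) : ℝ) := le_mul_of_one_le_left (by positivity) (by exact_mod_cast hq)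
    calc x ≤ ((N + 1 : ℕ) : ℝ) := h1.le
      _ ≤ ((N + 1 : ℕ) : ℝ) ^ 4 := le_self_pow₀ h2 (by norm_num)
      _ ≤ (q * ((N + 1 : ℕ) : ℝ)) ^ 4 := by gcongr
  -- the sum over `Icc 1 N` as a range sum of `g`
  have hIcc : ∑ k ∈ Icc 1 N, fiSlice x ((k * q : ℕ) : ℝ) = ∑ i ∈ range N, g ((i + 1 : ℕ) : ℝ) := by
    rw [← Finset.Ico_add_one_right_eq_Icc, sum_Ico_eq_sum_range]
    refine sum_congr (by simp) fun i _ => ?_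
    rw [hg]; push_cast; ring_nf
  have hS1 : ∑ k ∈ Icc 1 N, fiSlice x ((k * q : ℕ) : ℝ) = ∑ i ∈ range (N + 1), g ((i + 1 : ℕ) : ℝ) := by
    rw [sum_range_succ, hzero, add_zero, hIcc]
  have hS0 : ∑ i ∈ range (N + 1), g (i : ℝ) = ∑ k ∈ Icc 1 N, fiSlice x ((k * q : ℕ) : ℝ) + g 0 := by
    rw [sum_range_succ', hIcc]; simp
  have hg0 : g 0 = Real.sqrt x := by rw [hg]; simp [fiSlice_zero]
  rw [abs_le]
  constructor
  · -- from `∫ ≤ Σ_{i ≤ N} g(i) = S + √x`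
    have := hup; rw [hint, hS0, hg0] at this; linarith
  · have := hlow; rw [hint, ← hS1] at this; linarith [Real.sqrt_nonneg x]


/-- **Möbius inversion of a gcd condition**: for `e ∣ r`, `r ≥ 1`,
`Σ_{1 ≤ c ≤ N, gcd(c, r) = e} f(c) = Σ_{m ∣ r/e} μ(m) Σ_{1 ≤ c ≤ N, em ∣ c} f(c)`. [folklore] -/
theorem sum_filter_gcd_eq_eq_sum_moebius {r e : ℕ} (hr : 0 < r) (he : e ∣ r) (N : ℕ) (f : ℕ → ℝ) :
    ∑ c ∈ (Icc 1 N).filter (fun c => Nat.gcd c r = e), f c =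
      ∑ m ∈ (r / e).divisors, (μ m : ℝ) * ∑ c ∈ (Icc 1 N).filter (fun c => e * m ∣ c), f c := by
  obtain ⟨q, rfl⟩ := he
  have he0 : 0 < e := Nat.pos_of_ne_zero fun h0 => by simp [h0] at hr
  have hq0 : 0 < q := Nat.pos_of_ne_zero fun h0 => by simp [h0] at hr
  rw [Nat.mul_div_cancel_left q he0]
  -- swap the sums on the right
  simp_rw [Finset.mul_sum, Finset.sum_filter]
  rw [Finset.sum_comm]
  refine Finset.sum_congr rfl fun c _ => ?_
  -- compare the indicator of `gcd(c, eq) = e` with `Σ_{m ∣ q, em ∣ c} μ(m)`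
  by_cases hec : e ∣ c
  · obtain ⟨c', rfl⟩ := hec
    have hset : ∀ m ∈ q.divisors, (e * m ∣ e * c' ↔ m ∈ (Nat.gcd c' q).divisors) := by
      intro m hm
      rw [Nat.mul_dvd_mul_iff_left he0, Nat.mem_divisors, Nat.dvd_gcd_iff]
      exact ⟨fun h => ⟨⟨h, Nat.dvd_of_mem_divisors hm⟩, Nat.gcd_ne_zero_right hq0.ne'⟩, fun h => h.1.1⟩
    have hsub : (Nat.gcd c' q).divisors ⊆ q.divisors :=
      Nat.divisors_subset_of_dvd hq0.ne' (Nat.gcd_dvd_right _ _)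
    calc (if Nat.gcd (e * c') (e * q) = e then f (e * c') else 0)
        = f (e * c') * (if Nat.gcd c' q = 1 then 1 else 0) := by
          rw [Nat.gcd_mul_left]
          by_cases h1 : Nat.gcd c' q = 1
          · rw [if_pos h1, if_pos (by rw [h1, mul_one]), mul_one]
          · rw [if_neg h1, if_neg (fun h => h1 (Nat.eq_of_mul_eq_mul_left he0 (h.trans (mul_one e).symm))),
              mul_zero]
      _ = f (e * c') * ∑ m ∈ (Nat.gcd c' q).divisors, (μ m : ℝ) := by
          -- `Σ_{d ∣ n} μ(d) = [n = 1]` (Mathlib's `μ * ζ = 1`; = `Literature.NumberTheory.Sieve.sum_divisors_moebius_real` of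
          -- `SieveFrameworkProofs`, not in the import closure)
          have hμζ : ∀ n : ℕ, ∑ d ∈ n.divisors, (μ d : ℝ) = if n = 1 then 1 else 0 := fun n => by
            have h := congrArg (fun f : ArithmeticFunction ℝ => f n)
              (ArithmeticFunction.coe_moebius_mul_coe_zeta (R := ℝ))
            simpa only [ArithmeticFunction.coe_mul_zeta_apply, ArithmeticFunction.intCoe_apply,
              ArithmeticFunction.one_apply] using h
          rw [hμζ]
      _ = ∑ m ∈ (Nat.gcd c' q).divisors, (μ m : ℝ) * f (e * c') := by rw [Finset.mul_sum]; simp_rw [mul_comm]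
      _ = ∑ m ∈ q.divisors, (if e * m ∣ e * c' then (μ m : ℝ) * f (e * c') else 0) := by
          rw [← Finset.sum_filter]
          refine Finset.sum_congr ?_ fun _ _ => rfl
          ext m
          simp only [mem_filter]
          constructor
          · intro hm; exact ⟨hsub hm, (hset m (hsub hm)).mpr hm⟩
          · rintro ⟨hm, hdvd⟩; exact (hset m hm).mp hdvd
  · -- `e ∤ c`: both sides vanish
    have h1 : ¬Nat.gcd c (e * q) = e := fun h => hec (h ▸ Nat.gcd_dvd_left c (e * q))
    rw [if_neg h1]
    refine (Finset.sum_eq_zero fun m _ => ?_).symm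
    rw [if_neg (fun h => hec ((dvd_mul_right e m).trans h))]


/-- `Σ_{c mod d} ρ(c²; d) = ν(d)`. [folklore] -/
theorem sum_range_sqCongrCount_eq_fiNu (d : ℕ) :
    ∑ c ∈ range d, sqCongrCount d (-(c : ℤ) ^ 4) = fiNu d := by
  rw [fiNu_eq_sum]
  exact Finset.sum_congr rfl fun c _ => sqCongrCount_neg_pow_four d c

/-- A sum over `range (r k)` of an `r`-periodic function is `k` times the sum over a period.
[folklore] -/
theorem sum_range_mul_of_periodic {M : Type*} [AddCommMonoid M] (F : ℕ → M) {r : ℕ}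
    (hF : ∀ c, F (c + r) = F c) (k : ℕ) : ∑ c ∈ range (r * k), F c = k • ∑ c ∈ range r, F c := by
  induction k with
  | zero => simp
  | succ k ih =>
    rw [Nat.mul_succ, Finset.sum_range_add, ih, succ_nsmul]
    congr 1
    refine Finset.sum_congr rfl fun c _ => ?_
    -- `F (r k + c) = F c` by `k` applications of periodicity
    have : ∀ j c, F (c + r * j) = F c := by
      intro j; induction j with
      | zero => intro c; simp
      | succ j ihj => intro c; rw [Nat.mul_succ, ← add_assoc, hF, ihj]
    rw [add_comm, this]

/-- For cubefree `d` with radical `r = ∏_{p ∣ d} p`: `c ↦ ρ(c²; d)` is `r`-periodic. [folklore] -/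
theorem sqCongrCount_neg_pow_four_periodic {d : ℕ} (hd : d ≠ 0) (hcf : IsCubefree d) (c : ℕ) :
    sqCongrCount d (-((c + ∏ p ∈ d.primeFactors, p : ℕ) : ℤ) ^ 4) = sqCongrCount d (-(c : ℤ) ^ 4) := by
  refine sqCongrCount_neg_pow_four_congr _ _ d hd hcf fun p hp => ?_
  have hpr : p ∣ ∏ q ∈ d.primeFactors, q := Finset.dvd_prod_of_mem _ hp
  exact (Nat.dvd_add_left hpr)

/-- For cubefree `d` with radical `r`: `ρ(c²; d) = ρ(gcd(c, r)²; d)`. [folklore] -/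
theorem sqCongrCount_neg_pow_four_eq_gcd {d : ℕ} (hd : d ≠ 0) (hcf : IsCubefree d) (c : ℕ) :
    sqCongrCount d (-(c : ℤ) ^ 4) =
      sqCongrCount d (-((Nat.gcd c (∏ p ∈ d.primeFactors, p) : ℕ) : ℤ) ^ 4) := by
  refine sqCongrCount_neg_pow_four_congr _ _ d hd hcf fun p hp => ?_
  have hpr : p ∣ ∏ q ∈ d.primeFactors, q := Finset.dvd_prod_of_mem _ hp
  constructor
  · intro hpc; exact Nat.dvd_gcd hpc hpr
  · intro h; exact h.trans (Nat.gcd_dvd_left _ _)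

/-- **The mean of `ρ(c²; d)`**: for cubefree `d ≥ 1` with radical `r`,
`Σ_{e ∣ r} ρ(e²; d) φ(r/e) = Σ_{c mod r} ρ(c²; d) = (r/d) ν(d)`, i.e. the `c`-average of
`ρ(c²; d)` over any period is `ν(d)/d = g(d) d`. [folklore] -/
theorem sum_divisors_sqCongrCount_mul_totient {d : ℕ} (hd : d ≠ 0) (hcf : IsCubefree d) :
    (∑ e ∈ (∏ p ∈ d.primeFactors, p).divisors,
        (sqCongrCount d (-(e : ℤ) ^ 4) : ℝ) * Nat.totient ((∏ p ∈ d.primeFactors, p) / e)) *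
      ((d : ℝ) / ∏ p ∈ d.primeFactors, (p : ℝ)) = fiNu d := by
  set r := ∏ p ∈ d.primeFactors, p with hr
  have hr0 : 0 < r := Finset.prod_pos fun p hp => (Nat.prime_of_mem_primeFactors hp).pos
  have hrd : r ∣ d := Nat.prod_primeFactors_dvd d
  obtain ⟨k, hk⟩ := hrd
  have hk0 : 0 < k := Nat.pos_of_ne_zero fun h => hd (by rw [hk, h, mul_zero])
  -- `Σ_{c mod r} ρ(c²; d) = Σ_e ρ(e²; d) φ(r/e)`
  have hgroup : ∑ c ∈ range r, (sqCongrCount d (-(c : ℤ) ^ 4) : ℝ) =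
      ∑ e ∈ r.divisors, (sqCongrCount d (-(e : ℤ) ^ 4) : ℝ) * Nat.totient (r / e) := by
    rw [← Finset.sum_fiberwise_of_maps_to (g := fun c => Nat.gcd c r) (t := r.divisors)
      (fun c _ => Nat.mem_divisors.mpr ⟨Nat.gcd_dvd_right _ _, hr0.ne'⟩)]
    refine Finset.sum_congr rfl fun e he => ?_
    have hediv : e ∣ r := Nat.dvd_of_mem_divisors he
    rw [Finset.sum_congr rfl (g := fun _ => (sqCongrCount d (-(e : ℤ) ^ 4) : ℝ)) fun c hc => by
      rw [sqCongrCount_neg_pow_four_eq_gcd hd hcf c, ← hr, (Finset.mem_filter.mp hc).2],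
      Finset.sum_const, nsmul_eq_mul, card_range_filter_gcd_eq hediv, mul_comm]
  -- `Σ_{c mod d} = k · Σ_{c mod r}` by periodicity, and `= ν(d)`
  have hper : ∑ c ∈ range d, (sqCongrCount d (-(c : ℤ) ^ 4) : ℝ) =
      k • ∑ c ∈ range r, (sqCongrCount d (-(c : ℤ) ^ 4) : ℝ) := by
    have hrange : range d = range (r * k) := congrArg range hk
    rw [hrange]
    refine sum_range_mul_of_periodic (fun c => (sqCongrCount d (-(c : ℤ) ^ 4) : ℝ)) (fun c => ?_) k
    have := sqCongrCount_neg_pow_four_periodic hd hcf c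
    rw [← hr] at this
    exact_mod_cast this
  have hnu : ∑ c ∈ range d, (sqCongrCount d (-(c : ℤ) ^ 4) : ℝ) = fiNu d := by
    exact_mod_cast sum_range_sqCongrCount_eq_fiNu d
  rw [← hgroup, ← hnu, hper, nsmul_eq_mul]
  have hr0' : (r : ℝ) ≠ 0 := by exact_mod_cast hr0.ne'
  have hdk : (d : ℝ) = (r : ℝ) * k := by exact_mod_cast hk
  have hrR : (∏ p ∈ d.primeFactors, (p : ℝ)) = (r : ℝ) := by rw [hr, Nat.cast_prod]
  rw [hdk, hrR]
  field_simp


/-! ### `d · M_d(x)` as a weighted sum of slices -/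

/-- `fiPoints X` is `fiDisc X` without the origin. [folklore] -/
theorem fiDisc_eq_insert_fiPoints (X : ℕ) : fiDisc X = insert ((0 : ℤ), (0 : ℤ)) (fiPoints X) := by
  ext ⟨a, c⟩
  simp only [fiDisc, fiPoints, mem_insert, mem_filter, mem_Icc, Prod.mk.injEq]
  constructor
  · rintro ⟨hbox, hle⟩
    by_cases h0 : a = 0 ∧ c = 0
    · exact Or.inl h0
    · refine Or.inr ⟨hbox, ?_, ?_⟩
      · -- `1 ≤ a² + c⁴`
        have hq : (fiQuartic (a, c) : ℤ) = a ^ 2 + c ^ 4 := fiQuartic_cast (a, c)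
        have hpos : 0 < a ^ 2 + c ^ 4 := by
          rcases not_and_or.mp h0 with ha | hc
          · have : 0 < a ^ 2 := by positivity
            nlinarith [sq_nonneg (c ^ 2)]
          · have : 0 < c ^ 4 := by positivity
            nlinarith [sq_nonneg a]
        have : (1 : ℤ) ≤ fiQuartic (a, c) := by rw [hq]; omega
        exact_mod_cast this
      · have hq : (fiQuartic (a, c) : ℤ) = a ^ 2 + c ^ 4 := fiQuartic_cast (a, c)
        have : (fiQuartic (a, c) : ℤ) ≤ X := by rw [hq]; exact hle
        exact_mod_cast this
  · rintro (⟨rfl, rfl⟩ | ⟨hbox, h1, h2⟩)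
    · simp [fiBox]
    · refine ⟨hbox, ?_⟩
      have hq : (fiQuartic (a, c) : ℤ) = a ^ 2 + c ^ 4 := fiQuartic_cast (a, c)
      rw [← hq]; exact_mod_cast h2

/-- The origin is not in `fiPoints`. [folklore] -/
theorem origin_not_mem_fiPoints (X : ℕ) : ((0 : ℤ), (0 : ℤ)) ∉ fiPoints X := by
  simp [fiPoints, fiQuartic]

/-- **`d · M_d(x)` as a weighted slice count**: with `ρ(c) = ρ(c²; d)` and `X = ⌊x⌋`,
`d M_d(x) = Σ_{|c| ≤ X} ρ(c) #{a ∈ [-X, X] : a² + c⁴ ≤ X} - ρ(0)`. [folklore] -/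
theorem mul_fiMainTerm_eq (d : ℕ) (x : ℝ) :
    (d : ℝ) * fiMainTerm d x =
      (∑ c ∈ Icc (-(⌊x⌋₊ : ℤ)) ⌊x⌋₊, (sqCongrCount d (-c ^ 4) : ℝ) *
          #{a ∈ Icc (-(⌊x⌋₊ : ℤ)) ⌊x⌋₊ | a ^ 2 + c ^ 4 ≤ (⌊x⌋₊ : ℤ)}) -
        sqCongrCount d 0 := by
  rcases Nat.eq_zero_or_pos d with rfl | hd
  · simp [fiMainTerm, sqCongrCount]
  set X := ⌊x⌋₊ with hX
  have hd0 : (d : ℝ) ≠ 0 := by exact_mod_cast hd.ne'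
  rw [fiMainTerm, mul_div_cancel₀ _ hd0]
  -- pass to `fiDisc` and fibre over `c`
  have h1 : ∑ ac ∈ fiDisc X, (sqCongrCount d (-(ac.2) ^ 4) : ℝ) =
      ∑ ac ∈ fiPoints X, (sqCongrCount d (-(ac.2) ^ 4) : ℝ) + sqCongrCount d 0 := by
    rw [fiDisc_eq_insert_fiPoints, Finset.sum_insert (origin_not_mem_fiPoints X), add_comm]
    simp
  have h2 : ∑ ac ∈ fiDisc X, (sqCongrCount d (-(ac.2) ^ 4) : ℝ) =
      ∑ c ∈ Icc (-(X : ℤ)) X, (sqCongrCount d (-c ^ 4) : ℝ) *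
        #{a ∈ Icc (-(X : ℤ)) X | a ^ 2 + c ^ 4 ≤ (X : ℤ)} := by
    rw [fiDisc, fiBox, Finset.sum_filter, Finset.sum_product_right]
    refine Finset.sum_congr rfl fun c _ => ?_
    rw [Finset.card_eq_sum_ones, Nat.cast_sum, Finset.mul_sum, Finset.sum_filter]
    refine Finset.sum_congr rfl fun a _ => ?_
    split_ifs <;> simp
  linarith [h1, h2]


/-- `√(x - c⁴) = 0` for natural `c > ⌊x⌋`, `x ≥ 1`. [folklore] -/
theorem fiSlice_natCast_eq_zero {x : ℝ} (hx : 1 ≤ x) {c : ℕ} (hc : ⌊x⌋₊ < c) : fiSlice x (c : ℝ) = 0 := by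
  refine fiSlice_eq_zero ?_
  have h1 : x < c := Nat.lt_of_floor_lt hc
  have h2 : (1 : ℝ) ≤ c := by
    have : 1 ≤ c := by have := Nat.floor_pos.mpr hx; omega
    exact_mod_cast this
  calc x ≤ (c : ℝ) := h1.le
    _ ≤ (c : ℝ) ^ 4 := le_self_pow₀ h2 (by norm_num)

/-- The multiples of `q ≥ 1` in `[1, X]` are the `k q`, `1 ≤ k ≤ X/q`. [folklore] -/
theorem Icc_filter_dvd_eq_image {q : ℕ} (hq : 1 ≤ q) (X : ℕ) :
    (Icc 1 X).filter (q ∣ ·) = (Icc 1 (X / q)).image (fun k => k * q) := by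
  ext c
  simp only [mem_filter, mem_Icc, mem_image]
  constructor
  · rintro ⟨⟨h1, h2⟩, ⟨k, rfl⟩⟩
    refine ⟨k, ⟨?_, ?_⟩, by ring⟩
    · rcases Nat.eq_zero_or_pos k with rfl | hk
      · simp at h1
      · exact hk
    · rw [Nat.le_div_iff_mul_le hq]; rwa [mul_comm] at h2
  · rintro ⟨k, ⟨h1, h2⟩, rfl⟩
    refine ⟨⟨Nat.one_le_iff_ne_zero.mpr (Nat.mul_ne_zero (by omega) (by omega)), ?_⟩, dvd_mul_left _ _⟩
    exact (Nat.le_div_iff_mul_le hq).mp h2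

/-- **Progression sums, reindexed**: for `q ≥ 1`, `x ≥ 1`,
`Σ_{1 ≤ c ≤ ⌊x⌋, q ∣ c} √(x - c⁴) = Σ_{1 ≤ k ≤ ⌊x⌋} √(x - (kq)⁴)` (the extra terms vanish). [folklore] -/
theorem sum_filter_dvd_fiSlice_eq {x : ℝ} (hx : 1 ≤ x) {q : ℕ} (hq : 1 ≤ q) :
    ∑ c ∈ (Icc 1 ⌊x⌋₊).filter (q ∣ ·), fiSlice x (c : ℝ) =
      ∑ k ∈ Icc 1 ⌊x⌋₊, fiSlice x ((k * q : ℕ) : ℝ) := by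
  set X := ⌊x⌋₊ with hX
  -- the multiples of `q` in `[1, X]` are `k q`, `1 ≤ k ≤ X / q`
  have himg := Icc_filter_dvd_eq_image hq X
  have hinj : Set.InjOn (fun k => k * q) ↑(Icc 1 (X / q)) := fun a _ b _ h =>
    Nat.eq_of_mul_eq_mul_right hq h
  rw [himg, Finset.sum_image hinj]
  -- extend `k` from `[1, X/q]` to `[1, X]`: the added terms vanish
  have hsub : Icc 1 (X / q) ⊆ Icc 1 X := Icc_subset_Icc_right (Nat.div_le_self _ _)
  rw [← Finset.sum_sdiff hsub]
  have hzero : ∑ k ∈ Icc 1 X \ Icc 1 (X / q), fiSlice x ((k * q : ℕ) : ℝ) = 0 := by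
    refine Finset.sum_eq_zero fun k hk => ?_
    have hk' := mem_sdiff.mp hk
    have hk1 := mem_Icc.mp hk'.1
    have hkq : X / q < k := by
      by_contra h
      exact hk'.2 (mem_Icc.mpr ⟨hk1.1, not_lt.mp h⟩)
    refine fiSlice_natCast_eq_zero hx ?_
    -- `X < k q`
    have := (Nat.div_lt_iff_lt_mul hq).mp hkq
    linarith
  rw [hzero, zero_add]


/-- **Symmetry in `c`**: with the even weight `ρ(c) = ρ(c²; d)`,
`Σ_{|c| ≤ X} ρ(c) √(x - c⁴) = ρ(0) √x + 2 Σ_{1 ≤ c ≤ X} ρ(c) √(x - c⁴)` (`X = ⌊x⌋`, `c ∈ ℕ` on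
the right). [folklore] -/
theorem sum_Icc_sqCongrCount_fiSlice (d : ℕ) (x : ℝ) :
    ∑ c ∈ Icc (-(⌊x⌋₊ : ℤ)) ⌊x⌋₊, (sqCongrCount d (-c ^ 4) : ℝ) * fiSlice x c =
      (sqCongrCount d 0 : ℝ) * Real.sqrt x +
        2 * ∑ c ∈ Icc 1 ⌊x⌋₊, (sqCongrCount d (-(c : ℤ) ^ 4) : ℝ) * fiSlice x (c : ℝ) := by
  set X := ⌊x⌋₊ with hX
  set h : ℤ → ℝ := fun c => (sqCongrCount d (-c ^ 4) : ℝ) * fiSlice x c with hh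
  have heven : ∀ c, h (-c) = h c := fun c => by
    simp only [hh, Int.cast_neg, fiSlice_neg, show (-c) ^ 4 = c ^ 4 by ring]
  rw [← Finset.sum_filter_add_sum_filter_not (Icc (-(X : ℤ)) X) (· = 0)]
  have h0 : (Icc (-(X : ℤ)) X).filter (· = 0) = {0} := by
    ext c; simp only [mem_filter, mem_Icc, mem_singleton]; constructor
    · rintro ⟨-, rfl⟩; rfl
    · rintro rfl; exact ⟨⟨by omega, by omega⟩, rfl⟩
  rw [h0, sum_singleton]
  change h 0 + ∑ c ∈ (Icc (-(X : ℤ)) X).filter (fun c => ¬c = 0), h c = _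
  rw [sum_Icc_neg_filter_ne_zero heven X, sum_Icc_int_eq_sum_Icc_nat]
  simp only [hh, Int.cast_zero, fiSlice_zero, Int.cast_natCast]
  norm_num

/-- **Fibering `Σ_{1 ≤ c ≤ X} ρ(c²; d) √(x - c⁴)` by `e = gcd(c, r)`** (cubefree `d ≥ 1`,
`r` its radical): `= Σ_{e ∣ r} ρ(e²; d) Σ_{1 ≤ c ≤ X, gcd(c, r) = e} √(x - c⁴)`. [folklore] -/
theorem sum_Icc_sqCongrCount_fiSlice_eq_sum_divisors {d : ℕ} (hd : d ≠ 0) (hcf : IsCubefree d) (x : ℝ) :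
    ∑ c ∈ Icc 1 ⌊x⌋₊, (sqCongrCount d (-(c : ℤ) ^ 4) : ℝ) * fiSlice x (c : ℝ) =
      ∑ e ∈ (∏ p ∈ d.primeFactors, p).divisors, (sqCongrCount d (-(e : ℤ) ^ 4) : ℝ) *
        ∑ c ∈ (Icc 1 ⌊x⌋₊).filter (fun c => Nat.gcd c (∏ p ∈ d.primeFactors, p) = e), fiSlice x (c : ℝ) := by
  set r := ∏ p ∈ d.primeFactors, p with hr
  have hr0 : 0 < r := Finset.prod_pos fun p hp => (Nat.prime_of_mem_primeFactors hp).pos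
  rw [← Finset.sum_fiberwise_of_maps_to (g := fun c => Nat.gcd c r) (t := r.divisors)
    (fun c _ => Nat.mem_divisors.mpr ⟨Nat.gcd_dvd_right _ _, hr0.ne'⟩)]
  refine Finset.sum_congr rfl fun e _ => ?_
  rw [Finset.mul_sum]
  refine Finset.sum_congr rfl fun c hc => ?_
  rw [sqCongrCount_neg_pow_four_eq_gcd hd hcf c, ← hr, (Finset.mem_filter.mp hc).2]


/-! ### A uniform bound for `ρ(c²; d)` on cubefree `d` -/

/-- For cubefree `d ≥ 1` and every `c`: `ρ(c²; d) = N(d, -c⁴) ≤ τ(d)² Σ_{g ∣ d, g² ∣ d} g`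
(from `sqCongrCount_cubefree_le`: `N(d, -c⁴) ≤ τ(d)² g` for some `g² ∣ d`). [folklore] -/
theorem sqCongrCount_neg_pow_four_le_sum {d : ℕ} (hd : d ≠ 0) (hcf : IsCubefree d) (c : ℤ) :
    (sqCongrCount d (-c ^ 4) : ℝ) ≤
      (#d.divisors : ℝ) ^ 2 * ∑ g ∈ d.divisors with g ^ 2 ∣ d, (g : ℝ) := by
  obtain ⟨g, -, hg2, hle⟩ := sqCongrCount_cubefree_le c d hd hcf
  have hgd : g ∣ d := (dvd_pow_self g two_ne_zero).trans hg2
  have hmem : g ∈ d.divisors.filter (fun g => g ^ 2 ∣ d) :=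
    mem_filter.mpr ⟨Nat.mem_divisors.mpr ⟨hgd, hd⟩, hg2⟩
  have h1 : (g : ℝ) ≤ ∑ g ∈ d.divisors with g ^ 2 ∣ d, (g : ℝ) :=
    single_le_sum (f := fun g : ℕ => (g : ℝ)) (fun _ _ => Nat.cast_nonneg _) hmem
  calc (sqCongrCount d (-c ^ 4) : ℝ) ≤ (#d.divisors : ℝ) ^ 2 * g := by exact_mod_cast hle
    _ ≤ _ := by gcongr

/-- `g(d) ≤ τ(d)² (Σ_{g ∣ d, g² ∣ d} g) / d` for cubefree `d ≥ 1` (`g(d) d² = ν(d) = Σ_{c mod d} ρ(c²; d)`).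
[folklore] -/
theorem fiDensity_le_of_isCubefree {d : ℕ} (hd : d ≠ 0) (hcf : IsCubefree d) :
    fiDensity d ≤ (#d.divisors : ℝ) ^ 2 * (∑ g ∈ d.divisors with g ^ 2 ∣ d, (g : ℝ)) / d := by
  set B := (#d.divisors : ℝ) ^ 2 * ∑ g ∈ d.divisors with g ^ 2 ∣ d, (g : ℝ) with hB
  have hd0 : (0 : ℝ) < d := by exact_mod_cast Nat.pos_of_ne_zero hd
  have hν : (fiNu d : ℝ) = fiDensity d * (d : ℝ) ^ 2 := fiNu_eq_fiDensity_mul_sq hcf hd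
  have hsum : ((∑ c ∈ range d, sqCongrCount d (-(c : ℤ) ^ 4) : ℕ) : ℝ) = fiNu d := by
    exact_mod_cast sum_range_sqCongrCount_eq_fiNu d
  have hle : (fiNu d : ℝ) ≤ d * B := by
    rw [← hsum, Nat.cast_sum]
    calc ∑ c ∈ range d, ((sqCongrCount d (-(c : ℤ) ^ 4) : ℕ) : ℝ) ≤ ∑ c ∈ range d, B :=
          sum_le_sum fun c _ => sqCongrCount_neg_pow_four_le_sum hd hcf c
      _ = d * B := by rw [sum_const, card_range, nsmul_eq_mul]
  rw [hν] at hle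
  rw [le_div_iff₀ hd0]
  have h2 : fiDensity d * d * d ≤ B * d := by nlinarith [hle]
  exact le_of_mul_le_mul_right h2 hd0

/-! ### Lemma 3.4: evaluation of `M_d(x)` -/

/-- Rounding the slices: with `N(c) = #{a ∈ [-X, X] : a² + c⁴ ≤ X}` (`X = ⌊x⌋`) and weights
`0 ≤ ρ(c) ≤ B`, `|Σ_{|c| ≤ X} ρ(c) N(c) - 2 Σ_{|c| ≤ X} ρ(c) √(x - c⁴)| ≤ 3B (2√x + 1)`
(`|N(c) - 2√(x - c⁴)| ≤ 3` on the `≤ 2√X + 1` slices with `c⁴ ≤ X`, `= 0` otherwise). [folklore] -/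
theorem abs_sum_sqCongrCount_card_sub_le (d : ℕ) {x : ℝ} (hx : 0 ≤ x) {B : ℝ}
    (hB : ∀ c : ℤ, (sqCongrCount d (-c ^ 4) : ℝ) ≤ B) :
    |∑ c ∈ Icc (-(⌊x⌋₊ : ℤ)) ⌊x⌋₊, (sqCongrCount d (-c ^ 4) : ℝ) *
          #{a ∈ Icc (-(⌊x⌋₊ : ℤ)) ⌊x⌋₊ | a ^ 2 + c ^ 4 ≤ (⌊x⌋₊ : ℤ)} -
        2 * ∑ c ∈ Icc (-(⌊x⌋₊ : ℤ)) ⌊x⌋₊, (sqCongrCount d (-c ^ 4) : ℝ) * fiSlice x c| ≤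
      3 * B * (2 * Real.sqrt x + 1) := by
  set X := ⌊x⌋₊ with hX
  have hB0 : 0 ≤ B := (Nat.cast_nonneg _).trans (hB 0)
  rw [Finset.mul_sum, ← Finset.sum_sub_distrib]
  have hterm : ∀ c ∈ Icc (-(X : ℤ)) X,
      |(sqCongrCount d (-c ^ 4) : ℝ) * #{a ∈ Icc (-(X : ℤ)) X | a ^ 2 + c ^ 4 ≤ (X : ℤ)} -
          2 * ((sqCongrCount d (-c ^ 4) : ℝ) * fiSlice x c)| ≤
        3 * B * (if c ^ 4 ≤ (X : ℤ) then (1 : ℝ) else 0) := by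
    intro c _
    have h1 := abs_card_slice_sub_le hx c
    rw [← hX] at h1
    rw [show (sqCongrCount d (-c ^ 4) : ℝ) * #{a ∈ Icc (-(X : ℤ)) X | a ^ 2 + c ^ 4 ≤ (X : ℤ)} -
          2 * ((sqCongrCount d (-c ^ 4) : ℝ) * fiSlice x c) =
        (sqCongrCount d (-c ^ 4) : ℝ) *
          ((#{a ∈ Icc (-(X : ℤ)) X | a ^ 2 + c ^ 4 ≤ (X : ℤ)} : ℝ) - 2 * fiSlice x c) by ring,
      abs_mul, abs_of_nonneg (Nat.cast_nonneg _)]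
    calc (sqCongrCount d (-c ^ 4) : ℝ) *
          |(#{a ∈ Icc (-(X : ℤ)) X | a ^ 2 + c ^ 4 ≤ (X : ℤ)} : ℝ) - 2 * fiSlice x c|
        ≤ B * (if c ^ 4 ≤ (X : ℤ) then (3 : ℝ) else 0) :=
          mul_le_mul (hB c) h1 (abs_nonneg _) hB0
      _ = 3 * B * (if c ^ 4 ≤ (X : ℤ) then (1 : ℝ) else 0) := by split_ifs <;> ring
  calc |∑ c ∈ Icc (-(X : ℤ)) X, ((sqCongrCount d (-c ^ 4) : ℝ) *
            #{a ∈ Icc (-(X : ℤ)) X | a ^ 2 + c ^ 4 ≤ (X : ℤ)} -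
          2 * ((sqCongrCount d (-c ^ 4) : ℝ) * fiSlice x c))|
      ≤ ∑ c ∈ Icc (-(X : ℤ)) X, |(sqCongrCount d (-c ^ 4) : ℝ) *
            #{a ∈ Icc (-(X : ℤ)) X | a ^ 2 + c ^ 4 ≤ (X : ℤ)} -
          2 * ((sqCongrCount d (-c ^ 4) : ℝ) * fiSlice x c)| := abs_sum_le_sum_abs _ _
    _ ≤ ∑ c ∈ Icc (-(X : ℤ)) X, 3 * B * (if c ^ 4 ≤ (X : ℤ) then (1 : ℝ) else 0) :=
        sum_le_sum hterm
    _ = 3 * B * #{c ∈ Icc (-(X : ℤ)) X | c ^ 4 ≤ (X : ℤ)} := by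
        rw [← Finset.mul_sum, Finset.sum_boole]
    _ ≤ 3 * B * ((2 * Nat.sqrt X + 1 : ℕ) : ℝ) := by
        gcongr
        exact_mod_cast card_filter_pow_four_le X
    _ ≤ 3 * B * (2 * Real.sqrt x + 1) := by
        have := nat_sqrt_floor_le_sqrt hx
        rw [← hX] at this
        push_cast
        gcongr

/-- **The arithmetic of the main term**: for cubefree `d ≥ 1`, `x ≥ 1` and `ρ(c²; d) ≤ B`,
`|Σ_{1 ≤ c ≤ x} ρ(c²; d) √(x - c⁴) - κ x^{3/4} ν(d)/d| ≤ τ(d)² B √x`: fibre by `e = (c, r)`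
(`r` the radical of `d`), Möbius-invert the gcd condition, evaluate each progression sum as
`κ x^{3/4}/q + O(√x)`, and recombine with `Σ_{m ∣ n} μ(m)/m = φ(n)/n` and
`Σ_{e ∣ r} ρ(e²; d) φ(r/e) = (r/d) ν(d)`. (FI obtain the same via
`ρ(ℓ²; d) = (ℓ, d₂) ρ(d₁d₂/(ℓ, d₁d₂))`.) [cite: FriedlanderIwaniecAnnals1998, Lemma 3.4, proof] -/
theorem abs_sum_Icc_sqCongrCount_fiSlice_sub_le {d : ℕ} (hd : d ≠ 0) (hcf : IsCubefree d)
    {x : ℝ} (hx : 1 ≤ x) {B : ℝ} (hB : ∀ c : ℕ, (sqCongrCount d (-(c : ℤ) ^ 4) : ℝ) ≤ B) :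
    |∑ c ∈ Icc 1 ⌊x⌋₊, (sqCongrCount d (-(c : ℤ) ^ 4) : ℝ) * fiSlice x (c : ℝ) -
        friedlanderIwaniecKappa * x ^ (3 / 4 : ℝ) * (fiNu d : ℝ) / d| ≤
      (#d.divisors : ℝ) ^ 2 * B * Real.sqrt x := by
  set r := ∏ p ∈ d.primeFactors, p with hr
  have hr0 : 0 < r := Finset.prod_pos fun p hp => (Nat.prime_of_mem_primeFactors hp).pos
  have hrd : r ∣ d := Nat.prod_primeFactors_dvd d
  set κx := friedlanderIwaniecKappa * x ^ (3 / 4 : ℝ) with hκx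
  have hB0 : 0 ≤ B := (Nat.cast_nonneg _).trans (hB 0)
  have hτr : ∀ {m : ℕ}, m ∣ d → (#m.divisors : ℝ) ≤ #d.divisors := fun hm => by
    exact_mod_cast card_le_card (Nat.divisors_subset_of_dvd hd hm)
  -- each gcd-class sum is `κx φ(r/e)/r + O(τ(r/e) √x)`
  have hinner : ∀ e ∈ r.divisors,
      |∑ c ∈ (Icc 1 ⌊x⌋₊).filter (fun c => Nat.gcd c r = e), fiSlice x (c : ℝ) -
          κx * (Nat.totient (r / e) : ℝ) / r| ≤ (#(r / e).divisors : ℝ) * Real.sqrt x := by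
    intro e he
    have her : e ∣ r := Nat.dvd_of_mem_divisors he
    have he0 : 0 < e := Nat.pos_of_mem_divisors he
    have hre0 : r / e ≠ 0 := (Nat.div_pos (Nat.le_of_dvd hr0 her) he0).ne'
    rw [sum_filter_gcd_eq_eq_sum_moebius hr0 her ⌊x⌋₊ (fun c => fiSlice x (c : ℝ))]
    have hmob : ∑ m ∈ (r / e).divisors, (ArithmeticFunction.moebius m : ℝ) / m =
        (Nat.totient (r / e) : ℝ) / (r / e : ℕ) :=
      Literature.NumberTheory.Sieve.SquarefreeSums.sum_divisors_moebius_div (r / e) hre0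
    have hcast : ((r / e : ℕ) : ℝ) = (r : ℝ) / e := Nat.cast_div her (by exact_mod_cast he0.ne')
    have he0' : (e : ℝ) ≠ 0 := by exact_mod_cast he0.ne'
    have hr0' : (r : ℝ) ≠ 0 := by exact_mod_cast hr0.ne'
    have hmain : κx * (Nat.totient (r / e) : ℝ) / r =
        ∑ m ∈ (r / e).divisors, (ArithmeticFunction.moebius m : ℝ) * (κx / ((e : ℝ) * m)) := by
      have : ∑ m ∈ (r / e).divisors, (ArithmeticFunction.moebius m : ℝ) * (κx / ((e : ℝ) * m)) =
          κx / e * ∑ m ∈ (r / e).divisors, (ArithmeticFunction.moebius m : ℝ) / m := by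
        rw [Finset.mul_sum]
        refine sum_congr rfl fun m _ => ?_
        ring
      rw [this, hmob, hcast]
      field_simp
    rw [hmain, ← Finset.sum_sub_distrib]
    calc |∑ m ∈ (r / e).divisors, ((ArithmeticFunction.moebius m : ℝ) *
              ∑ c ∈ (Icc 1 ⌊x⌋₊).filter (fun c => e * m ∣ c), fiSlice x (c : ℝ) -
            (ArithmeticFunction.moebius m : ℝ) * (κx / ((e : ℝ) * m)))|
        ≤ ∑ m ∈ (r / e).divisors, |(ArithmeticFunction.moebius m : ℝ) *
              ∑ c ∈ (Icc 1 ⌊x⌋₊).filter (fun c => e * m ∣ c), fiSlice x (c : ℝ) -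
            (ArithmeticFunction.moebius m : ℝ) * (κx / ((e : ℝ) * m))| := abs_sum_le_sum_abs _ _
      _ ≤ ∑ m ∈ (r / e).divisors, Real.sqrt x := by
          refine sum_le_sum fun m hm => ?_
          have hm0 : 0 < m := Nat.pos_of_mem_divisors hm
          have hq : 1 ≤ e * m := Nat.mul_pos he0 hm0
          rw [← mul_sub, abs_mul]
          have hμ : |(ArithmeticFunction.moebius m : ℝ)| ≤ 1 := by
            exact_mod_cast ArithmeticFunction.abs_moebius_le_one
          have hT := abs_sum_fiSlice_mul_sub_le hx hq
          rw [sum_filter_dvd_fiSlice_eq hx hq]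
          have hq' : κx / ((e : ℝ) * m) =
              friedlanderIwaniecKappa * x ^ (3 / 4 : ℝ) / ((e * m : ℕ) : ℝ) := by
            rw [hκx]; push_cast; ring
          rw [hq']
          calc |(ArithmeticFunction.moebius m : ℝ)| *
                |∑ k ∈ Icc 1 ⌊x⌋₊, fiSlice x ((k * (e * m) : ℕ) : ℝ) -
                  friedlanderIwaniecKappa * x ^ (3 / 4 : ℝ) / ((e * m : ℕ) : ℝ)|
              ≤ 1 * Real.sqrt x := mul_le_mul hμ hT (abs_nonneg _) zero_le_one
            _ = Real.sqrt x := one_mul _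
      _ = (#(r / e).divisors : ℝ) * Real.sqrt x := by rw [sum_const, nsmul_eq_mul]
  -- the main terms recombine to `κx ν(d)/d`
  have hmean := sum_divisors_sqCongrCount_mul_totient hd hcf
  rw [← hr] at hmean
  have hrR : (∏ p ∈ d.primeFactors, (p : ℝ)) = (r : ℝ) := by rw [hr, Nat.cast_prod]
  rw [hrR] at hmean
  have hd0 : (0 : ℝ) < d := by exact_mod_cast Nat.pos_of_ne_zero hd
  have hr0' : (r : ℝ) ≠ 0 := by exact_mod_cast hr0.ne'
  have hνd : κx * (fiNu d : ℝ) / d =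
      ∑ e ∈ r.divisors, (sqCongrCount d (-(e : ℤ) ^ 4) : ℝ) * (κx * (Nat.totient (r / e) : ℝ) / r) := by
    rw [← hmean]
    have : ∑ e ∈ r.divisors, (sqCongrCount d (-(e : ℤ) ^ 4) : ℝ) * (κx * (Nat.totient (r / e) : ℝ) / r) =
        κx / r * ∑ e ∈ r.divisors, (sqCongrCount d (-(e : ℤ) ^ 4) : ℝ) * Nat.totient (r / e) := by
      rw [Finset.mul_sum]
      refine sum_congr rfl fun e _ => ?_
      ring
    rw [this]
    field_simp
  rw [sum_Icc_sqCongrCount_fiSlice_eq_sum_divisors hd hcf x, ← hr, hνd, ← Finset.sum_sub_distrib]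
  calc |∑ e ∈ r.divisors, ((sqCongrCount d (-(e : ℤ) ^ 4) : ℝ) *
            ∑ c ∈ (Icc 1 ⌊x⌋₊).filter (fun c => Nat.gcd c r = e), fiSlice x (c : ℝ) -
          (sqCongrCount d (-(e : ℤ) ^ 4) : ℝ) * (κx * (Nat.totient (r / e) : ℝ) / r))|
      ≤ ∑ e ∈ r.divisors, |(sqCongrCount d (-(e : ℤ) ^ 4) : ℝ) *
            ∑ c ∈ (Icc 1 ⌊x⌋₊).filter (fun c => Nat.gcd c r = e), fiSlice x (c : ℝ) -
          (sqCongrCount d (-(e : ℤ) ^ 4) : ℝ) * (κx * (Nat.totient (r / e) : ℝ) / r)| :=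
        abs_sum_le_sum_abs _ _
    _ ≤ ∑ e ∈ r.divisors, B * ((#d.divisors : ℝ) * Real.sqrt x) := by
        refine sum_le_sum fun e he => ?_
        rw [← mul_sub, abs_mul, abs_of_nonneg (Nat.cast_nonneg _)]
        refine mul_le_mul (hB e) ((hinner e he).trans ?_) (abs_nonneg _) hB0
        have h1 : r / e ∣ d := (Nat.div_dvd_of_dvd (Nat.dvd_of_mem_divisors he)).trans hrd
        exact mul_le_mul_of_nonneg_right (hτr h1) (Real.sqrt_nonneg x)
    _ = (#r.divisors : ℝ) * (B * ((#d.divisors : ℝ) * Real.sqrt x)) := by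
        rw [sum_const, nsmul_eq_mul]
    _ ≤ (#d.divisors : ℝ) * (B * ((#d.divisors : ℝ) * Real.sqrt x)) := by
        refine mul_le_mul_of_nonneg_right (hτr hrd) ?_
        have := Real.sqrt_nonneg x
        positivity
    _ = (#d.divisors : ℝ) ^ 2 * B * Real.sqrt x := by ring

/-- **FI Lemma 3.4** (main-term evaluation, explicit form): for cubefree `d ≥ 1` and `x ≥ 1`,
`|M_d(x) - 4κ g(d) x^{3/4}| ≤ 16 τ(d)⁴ (Σ_{g ∣ d, g² ∣ d} g) √x / d`,
with `g` the density (3.16) (`fiDensity`; here `ν(d) = g(d) d²`, `fiNu_eq_fiDensity_mul_sq`) and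
`κ` the constant (1.2). FI print (3.15) as `M_d(x) = g(d) κ x^{3/4} + O(h(d) x^{1/2})`; the factor
`4` (present in (3.18), `A(x) = M_1(x) + O(…) = 4κ x^{3/4} + O(x^{1/2})`) is restored here, and the
multiplicative `h(d)` of (3.16) (`h(p)p = 1 + 2ρ(p)`, `h(p²)p² = p + 2ρ(p)`) is replaced by the
explicit majorant `16 τ(d)⁴ (Σ_{g² ∣ d} g)/d`, whose sum over `d ≤ D` is `≪ D^{1/8}`
(`sum_card_divisors_pow_mul_sum_sq_dvd_div_le`), which suffices for (3.19).
[cite: FriedlanderIwaniecAnnals1998, Lemma 3.4 (3.15)-(3.16)] -/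
theorem abs_fiMainTerm_sub_le {d : ℕ} (hd : d ≠ 0) (hcf : IsCubefree d) {x : ℝ} (hx : 1 ≤ x) :
    |fiMainTerm d x - 4 * friedlanderIwaniecKappa * fiDensity d * x ^ (3 / 4 : ℝ)| ≤
      16 * (#d.divisors : ℝ) ^ 4 * (∑ g ∈ d.divisors with g ^ 2 ∣ d, (g : ℝ)) *
        Real.sqrt x / d := by
  obtain ⟨B, hBdef⟩ : ∃ B : ℝ, B = (#d.divisors : ℝ) ^ 2 * ∑ g ∈ d.divisors with g ^ 2 ∣ d, (g : ℝ) :=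
    ⟨_, rfl⟩
  have hx0 : 0 ≤ x := by linarith
  have hBz : ∀ c : ℤ, (sqCongrCount d (-c ^ 4) : ℝ) ≤ B := fun c =>
    hBdef ▸ sqCongrCount_neg_pow_four_le_sum hd hcf c
  have hBn : ∀ c : ℕ, (sqCongrCount d (-(c : ℤ) ^ 4) : ℝ) ≤ B := fun c => hBz c
  have hB0 : 0 ≤ B := (Nat.cast_nonneg _).trans (hBz 0)
  have hρ0 : (sqCongrCount d 0 : ℝ) ≤ B := by simpa using hBz 0
  have hτ1 : (1 : ℝ) ≤ #d.divisors := by exact_mod_cast one_le_card_divisors hd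
  have hτ2 : (1 : ℝ) ≤ (#d.divisors : ℝ) ^ 2 := one_le_pow₀ hτ1
  have hd0 : (0 : ℝ) < d := by exact_mod_cast Nat.pos_of_ne_zero hd
  have hsx1 : 1 ≤ Real.sqrt x := by rw [← Real.sqrt_one]; exact Real.sqrt_le_sqrt hx
  -- the four ingredients
  have h1 := mul_fiMainTerm_eq d x
  have h2 := abs_sum_sqCongrCount_card_sub_le d hx0 hBz
  have h3 := sum_Icc_sqCongrCount_fiSlice d x
  have h4 := abs_sum_Icc_sqCongrCount_fiSlice_sub_le hd hcf hx hBn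
  rw [fiNu_eq_fiDensity_mul_sq hcf hd] at h4
  have hmain : friedlanderIwaniecKappa * x ^ (3 / 4 : ℝ) * (fiDensity d * (d : ℝ) ^ 2) / d =
      friedlanderIwaniecKappa * fiDensity d * x ^ (3 / 4 : ℝ) * d := by
    rw [div_eq_iff hd0.ne']; ring
  rw [hmain] at h4
  set P := ∑ c ∈ Icc (-(⌊x⌋₊ : ℤ)) ⌊x⌋₊, (sqCongrCount d (-c ^ 4) : ℝ) *
      #{a ∈ Icc (-(⌊x⌋₊ : ℤ)) ⌊x⌋₊ | a ^ 2 + c ^ 4 ≤ (⌊x⌋₊ : ℤ)} with hP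
  set Q := ∑ c ∈ Icc (-(⌊x⌋₊ : ℤ)) ⌊x⌋₊, (sqCongrCount d (-c ^ 4) : ℝ) * fiSlice x c with hQ
  set R := ∑ c ∈ Icc 1 ⌊x⌋₊, (sqCongrCount d (-(c : ℤ) ^ 4) : ℝ) * fiSlice x (c : ℝ) with hR
  set ρ0 := (sqCongrCount d 0 : ℝ) with hρ0def
  -- work with `d · M_d(x)`
  have key : |(d : ℝ) * fiMainTerm d x -
      4 * friedlanderIwaniecKappa * fiDensity d * x ^ (3 / 4 : ℝ) * d| ≤
      16 * (#d.divisors : ℝ) ^ 4 * (∑ g ∈ d.divisors with g ^ 2 ∣ d, (g : ℝ)) * Real.sqrt x := by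
    have hE : (d : ℝ) * fiMainTerm d x - 4 * friedlanderIwaniecKappa * fiDensity d * x ^ (3 / 4 : ℝ) * d =
        (P - 2 * Q) + 2 * (ρ0 * Real.sqrt x) +
          4 * (R - friedlanderIwaniecKappa * fiDensity d * x ^ (3 / 4 : ℝ) * d) - ρ0 := by
      rw [h1, h3]; ring
    rw [hE]
    have hρ0' : 0 ≤ ρ0 := Nat.cast_nonneg _
    have e1 := abs_sub (P - 2 * Q + 2 * (ρ0 * Real.sqrt x) +
      4 * (R - friedlanderIwaniecKappa * fiDensity d * x ^ (3 / 4 : ℝ) * d)) ρ0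
    have e2 := abs_add_three (P - 2 * Q) (2 * (ρ0 * Real.sqrt x))
      (4 * (R - friedlanderIwaniecKappa * fiDensity d * x ^ (3 / 4 : ℝ) * d))
    have e3 : |2 * (ρ0 * Real.sqrt x)| = 2 * (ρ0 * Real.sqrt x) := abs_of_nonneg (by positivity)
    have e4 : |4 * (R - friedlanderIwaniecKappa * fiDensity d * x ^ (3 / 4 : ℝ) * d)| =
        4 * |R - friedlanderIwaniecKappa * fiDensity d * x ^ (3 / 4 : ℝ) * d| := by
      rw [abs_mul, abs_of_pos (by norm_num : (0 : ℝ) < 4)]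
    have e5 : |ρ0| = ρ0 := abs_of_nonneg hρ0'
    have e6 : ρ0 * Real.sqrt x ≤ B * Real.sqrt x := mul_le_mul_of_nonneg_right hρ0 (Real.sqrt_nonneg x)
    have ha : B ≤ B * Real.sqrt x := le_mul_of_one_le_right hB0 hsx1
    have hb : B * Real.sqrt x ≤ (#d.divisors : ℝ) ^ 2 * (B * Real.sqrt x) :=
      le_mul_of_one_le_left (by positivity) hτ2
    calc |P - 2 * Q + 2 * (ρ0 * Real.sqrt x) +
            4 * (R - friedlanderIwaniecKappa * fiDensity d * x ^ (3 / 4 : ℝ) * d) - ρ0|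
        ≤ 3 * B * (2 * Real.sqrt x + 1) + 2 * (B * Real.sqrt x) +
            4 * ((#d.divisors : ℝ) ^ 2 * B * Real.sqrt x) + B := by
          linarith [e1, e2, e3, e4, e5, e6, h2, h4]
      _ ≤ 16 * ((#d.divisors : ℝ) ^ 2 * (B * Real.sqrt x)) := by linarith [ha, hb]
      _ = 16 * (#d.divisors : ℝ) ^ 4 * (∑ g ∈ d.divisors with g ^ 2 ∣ d, (g : ℝ)) * Real.sqrt x := by
          rw [hBdef]; ring
  -- divide by `d`
  rw [le_div_iff₀ hd0]
  calc |fiMainTerm d x - 4 * friedlanderIwaniecKappa * fiDensity d * x ^ (3 / 4 : ℝ)| * d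
      = |(d : ℝ) * fiMainTerm d x - 4 * friedlanderIwaniecKappa * fiDensity d * x ^ (3 / 4 : ℝ) * d| := by
        rw [← abs_of_pos hd0, ← abs_mul, abs_of_pos hd0]
        congr 1; ring
    _ ≤ _ := key


/-! ### Summing the majorant `τ(d)⁴ (Σ_{g² ∣ d} g)/d` over `d ≤ D` -/

/-- `Σ_{1 ≤ d ≤ D, g² ∣ d} g/d ≤ g⁻¹ Σ_{1 ≤ m ≤ D} 1/m` (`d = g² m`). [folklore] -/
theorem sum_filter_sq_dvd_div_le {g : ℕ} (hg : 1 ≤ g) (D : ℕ) :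
    ∑ d ∈ (Icc 1 D).filter (g ^ 2 ∣ ·), (g : ℝ) / d ≤ (g : ℝ)⁻¹ * ∑ m ∈ Icc 1 D, (m : ℝ)⁻¹ := by
  have hg2 : 1 ≤ g ^ 2 := Nat.one_le_pow _ _ hg
  have hinj : Set.InjOn (fun k => k * g ^ 2) ↑(Icc 1 (D / g ^ 2)) := fun a _ b _ h =>
    Nat.eq_of_mul_eq_mul_right hg2 h
  rw [Icc_filter_dvd_eq_image hg2 D, Finset.sum_image hinj]
  have hg0 : (0 : ℝ) < g := by exact_mod_cast hg
  calc ∑ k ∈ Icc 1 (D / g ^ 2), (g : ℝ) / ((k * g ^ 2 : ℕ) : ℝ)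
      = ∑ k ∈ Icc 1 (D / g ^ 2), (g : ℝ)⁻¹ * (k : ℝ)⁻¹ := by
        refine sum_congr rfl fun k hk => ?_
        have : ((k * g ^ 2 : ℕ) : ℝ) = (g : ℝ) * ((g : ℝ) * k) := by push_cast; ring
        rw [this, div_mul_eq_div_div, div_self hg0.ne', one_div, mul_inv]
    _ ≤ ∑ k ∈ Icc 1 D, (g : ℝ)⁻¹ * (k : ℝ)⁻¹ := by
        refine sum_le_sum_of_subset_of_nonneg (Icc_subset_Icc_right (Nat.div_le_self _ _)) ?_
        intro k _ _
        positivity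
    _ = (g : ℝ)⁻¹ * ∑ m ∈ Icc 1 D, (m : ℝ)⁻¹ := by rw [Finset.mul_sum]

/-- `Σ_{1 ≤ d ≤ D} (Σ_{g ∣ d, g² ∣ d} g)/d ≤ (Σ_{m ≤ D} 1/m)² ≤ (1 + log D)²`. [folklore] -/
theorem sum_sum_sq_dvd_div_le (D : ℕ) :
    ∑ d ∈ Icc 1 D, (∑ g ∈ d.divisors with g ^ 2 ∣ d, (g : ℝ)) / d ≤ (1 + Real.log D) ^ 2 := by
  have hH : ∑ m ∈ Icc 1 D, (m : ℝ)⁻¹ ≤ 1 + Real.log D := by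
    have := harmonic_le_one_add_log D
    rw [harmonic_eq_sum_Icc] at this
    push_cast at this
    exact this
  have hH0 : 0 ≤ ∑ m ∈ Icc 1 D, (m : ℝ)⁻¹ := sum_nonneg fun _ _ => by positivity
  have h1 : ∀ d ∈ Icc 1 D, (∑ g ∈ d.divisors with g ^ 2 ∣ d, (g : ℝ)) / d =
      ∑ g ∈ Icc 1 D, if g ^ 2 ∣ d then (g : ℝ) / d else 0 := by
    intro d hd
    have hd0 : d ≠ 0 := by have := (mem_Icc.mp hd).1; omega
    rw [Finset.sum_div, Finset.sum_filter]
    refine Finset.sum_subset (fun g hg => ?_) (fun g _ hgn => ?_)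
    · have hgd := Nat.dvd_of_mem_divisors hg
      exact mem_Icc.mpr ⟨Nat.pos_of_mem_divisors hg,
        (Nat.le_of_dvd (Nat.pos_of_ne_zero hd0) hgd).trans (mem_Icc.mp hd).2⟩
    · rw [if_neg]
      intro h2
      exact hgn (Nat.mem_divisors.mpr ⟨(dvd_pow_self g two_ne_zero).trans h2, hd0⟩)
  rw [sum_congr rfl h1, Finset.sum_comm]
  calc ∑ g ∈ Icc 1 D, ∑ d ∈ Icc 1 D, (if g ^ 2 ∣ d then (g : ℝ) / d else 0)
      ≤ ∑ g ∈ Icc 1 D, (g : ℝ)⁻¹ * ∑ m ∈ Icc 1 D, (m : ℝ)⁻¹ := by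
        refine sum_le_sum fun g hg => ?_
        rw [← Finset.sum_filter]
        exact sum_filter_sq_dvd_div_le (mem_Icc.mp hg).1 D
    _ = (∑ m ∈ Icc 1 D, (m : ℝ)⁻¹) ^ 2 := by rw [← Finset.sum_mul, sq]
    _ ≤ (1 + Real.log D) ^ 2 := pow_le_pow_left₀ hH0 hH 2

/-- **Summatory majorant.** There is `C > 0` with
`Σ_{1 ≤ d ≤ D} τ(d)⁴ (Σ_{g ∣ d, g² ∣ d} g)/d ≤ C D^{1/8}` for all `D` (divisor bound
`τ(d) ≪ d^{1/64}` and `Σ_{d ≤ D} (Σ_{g² ∣ d} g)/d ≤ (1 + log D)² ≤ 1089 D^{1/16}`); this replaces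
FI's `Σ³_{d ≤ x} h(d) ≪ (log x)⁴`, any bound `≪ D^{1/4}` being sufficient for (3.19). [folklore] -/
theorem sum_card_divisors_pow_mul_sum_sq_dvd_div_le :
    ∃ C : ℝ, 0 < C ∧ ∀ D : ℕ,
      ∑ d ∈ Icc 1 D, (#d.divisors : ℝ) ^ 4 * (∑ g ∈ d.divisors with g ^ 2 ∣ d, (g : ℝ)) / d ≤
        C * (D : ℝ) ^ (1 / 8 : ℝ) := by
  obtain ⟨C₁, hC₁, hτ⟩ := Literature.NumberTheory.Sieve.exists_card_divisors_le_mul_rpow (ε := 1 / 64) (by norm_num)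
  refine ⟨1089 * C₁ ^ 4, by positivity, fun D => ?_⟩
  rcases Nat.eq_zero_or_pos D with rfl | hD
  · rw [Finset.Icc_eq_empty_of_lt Nat.zero_lt_one, sum_empty, Nat.cast_zero,
      Real.zero_rpow (by norm_num), mul_zero]
  have hD1 : (1 : ℝ) ≤ D := by exact_mod_cast hD
  have hD0 : (0 : ℝ) < D := by linarith
  -- `τ(d)⁴ ≤ C₁⁴ D^{1/16}`
  have hτ4 : ∀ d ∈ Icc 1 D, (#d.divisors : ℝ) ^ 4 ≤ C₁ ^ 4 * (D : ℝ) ^ (1 / 16 : ℝ) := by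
    intro d hd
    obtain ⟨hd1, hdD⟩ := mem_Icc.mp hd
    have h := hτ d (by omega)
    have hdD' : (d : ℝ) ≤ D := by exact_mod_cast hdD
    calc (#d.divisors : ℝ) ^ 4 ≤ (C₁ * (d : ℝ) ^ (1 / 64 : ℝ)) ^ 4 :=
          pow_le_pow_left₀ (Nat.cast_nonneg _) h 4
      _ = C₁ ^ 4 * (d : ℝ) ^ (1 / 16 : ℝ) := by
          rw [mul_pow, ← Real.rpow_natCast ((d : ℝ) ^ (1 / 64 : ℝ)) 4,
            ← Real.rpow_mul (Nat.cast_nonneg _)]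
          norm_num
      _ ≤ C₁ ^ 4 * (D : ℝ) ^ (1 / 16 : ℝ) := by gcongr
  -- `(1 + log D)² ≤ 1089 D^{1/16}`
  have hlog : (1 + Real.log D) ^ 2 ≤ 1089 * (D : ℝ) ^ (1 / 16 : ℝ) := by
    have h1 : Real.log D ≤ (D : ℝ) ^ (1 / 32 : ℝ) / (1 / 32) :=
      Real.log_le_rpow_div hD0.le (by norm_num)
    have h2 : (1 : ℝ) ≤ (D : ℝ) ^ (1 / 32 : ℝ) := Real.one_le_rpow hD1 (by norm_num)
    have h3 : 0 ≤ Real.log D := Real.log_nonneg hD1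
    have h4 : 1 + Real.log D ≤ 33 * (D : ℝ) ^ (1 / 32 : ℝ) := by linarith
    have h5 : ((D : ℝ) ^ (1 / 32 : ℝ)) ^ 2 = (D : ℝ) ^ (1 / 16 : ℝ) := by
      rw [← Real.rpow_natCast ((D : ℝ) ^ (1 / 32 : ℝ)) 2, ← Real.rpow_mul hD0.le]
      norm_num
    calc (1 + Real.log D) ^ 2 ≤ (33 * (D : ℝ) ^ (1 / 32 : ℝ)) ^ 2 :=
          pow_le_pow_left₀ (by linarith) h4 2
      _ = 1089 * (D : ℝ) ^ (1 / 16 : ℝ) := by rw [mul_pow, h5]; norm_num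
  have hS0 : ∀ d ∈ Icc 1 D, 0 ≤ (∑ g ∈ d.divisors with g ^ 2 ∣ d, (g : ℝ)) / d :=
    fun d _ => by positivity
  calc ∑ d ∈ Icc 1 D, (#d.divisors : ℝ) ^ 4 * (∑ g ∈ d.divisors with g ^ 2 ∣ d, (g : ℝ)) / d
      ≤ ∑ d ∈ Icc 1 D, C₁ ^ 4 * (D : ℝ) ^ (1 / 16 : ℝ) *
          ((∑ g ∈ d.divisors with g ^ 2 ∣ d, (g : ℝ)) / d) := by
        refine sum_le_sum fun d hd => ?_
        rw [mul_div_assoc]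
        exact mul_le_mul_of_nonneg_right (hτ4 d hd) (hS0 d hd)
    _ = C₁ ^ 4 * (D : ℝ) ^ (1 / 16 : ℝ) *
          ∑ d ∈ Icc 1 D, (∑ g ∈ d.divisors with g ^ 2 ∣ d, (g : ℝ)) / d := by
        rw [Finset.mul_sum]
    _ ≤ C₁ ^ 4 * (D : ℝ) ^ (1 / 16 : ℝ) * (1089 * (D : ℝ) ^ (1 / 16 : ℝ)) := by
        gcongr
        exact (sum_sum_sq_dvd_div_le D).trans hlog
    _ = 1089 * C₁ ^ 4 * (D : ℝ) ^ (1 / 8 : ℝ) := by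
        rw [show (1 / 8 : ℝ) = 1 / 16 + 1 / 16 by norm_num, Real.rpow_add hD0]
        ring

end Literature.NumberTheory.Sieve.FriedlanderIwaniecPrimes

namespace Literature.NumberTheory.Sieve

open Filter Finset Real FriedlanderIwaniecPrimes

/-! ### Proposition 3.5 from Lemma 3.1 -/

/-- For `t < 1` all remainders `r_d(t)` of the sequence `a_n` vanish (`A_d(t) = A(t) = 0`).
[folklore] -/
theorem fiSieveSeq_remainder_eq_zero_of_lt_one {t : ℝ} (ht : t < 1) (d : ℕ) :
    fiSieveSeq.remainder d t = 0 := by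
  have h0 : ⌊t⌋₊ = 0 := Nat.floor_eq_zero.mpr ht
  have hA : fiCount t = 0 := by
    rw [fiCount, h0, Finset.Icc_eq_empty_of_lt Nat.zero_lt_one, sum_empty]
  rw [fiSieveSeq_remainder, SieveSequence.congrSum, h0, hA, Finset.Ioc_self, Finset.filter_empty,
    sum_empty, mul_zero, sub_zero]

/-- **FI Proposition 3.5 from Lemma 3.1** (the deduction printed before (3.19): "thus for `d`
cubefree the error term satisfies `r_d(x) = A_d(x) - M_d(x) + O(h(d) x^{1/2})` ... This together
with Lemma 3.1 implies Proposition 3.5"). Precisely: for cubefree `d` and `1 ≤ t ≤ x`,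
`r_d(t) = (A_d(t) - M_d(t)) + (M_d(t) - 4κ g(d) t^{3/4}) - g(d) (A(t) - 4κ t^{3/4})`; the first
terms sum to `≤ K_ε D^{1/4} t^{9/16+ε}` (Lemma 3.1, `FriedlanderIwaniec1998_lemma31`), the second
to `≤ 16 √t Σ_d τ(d)⁴ (Σ_{g² ∣ d} g)/d` (Lemma 3.4, `abs_fiMainTerm_sub_le`), the third to
`≤ 14 √t Σ_d g(d)` ((3.18) = `abs_fiCount_sub_le`, `g(d) ≤ τ(d)² (Σ_{g² ∣ d} g)/d`), and
`Σ_{d ≤ D} τ(d)⁴ (Σ_{g² ∣ d} g)/d ≪ D^{1/8}`, `√t ≤ x^{9/16}`; for `t < 1` everything vanishes.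
Hence `FriedlanderIwaniec1998_prop35` ((3.19), for all `D ≥ 1`, `t ≤ x`, `x ≥ 1`) follows from
`FriedlanderIwaniec1998_lemma31`. [cite: FriedlanderIwaniecAnnals1998, Proposition 3.5 (3.19), deduction from Lemma 3.1 and Lemma 3.4] -/
theorem FriedlanderIwaniec1998_prop35_of_lemma31 (h31 : FriedlanderIwaniec1998_lemma31) :
    FriedlanderIwaniec1998_prop35 := by
  intro ε hε
  obtain ⟨K₁, hK₁⟩ := h31 ε hε
  obtain ⟨C, hC0, hC⟩ := sum_card_divisors_pow_mul_sum_sq_dvd_div_le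
  refine ⟨max K₁ 0 + 30 * C, ?_⟩
  filter_upwards [eventually_ge_atTop (1 : ℝ)] with x hx D hD t htx
  have hx0 : 0 < x := by linarith
  have hD0 : 0 < D := by linarith
  have hK0 : 0 ≤ max K₁ 0 := le_max_right _ _
  have hRHS0 : 0 ≤ (max K₁ 0 + 30 * C) * D ^ (1 / 4 : ℝ) * x ^ (9 / 16 + ε : ℝ) := by positivity
  rcases lt_or_ge t 1 with ht | ht
  · -- `t < 1`: everything vanishes
    rw [Finset.sum_eq_zero fun d _ => by rw [fiSieveSeq_remainder_eq_zero_of_lt_one ht, abs_zero]]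
    exact hRHS0
  -- `1 ≤ t ≤ x`
  have ht0 : 0 < t := by linarith
  -- pointwise: `|r_d(t)| ≤ |A_d(t) - M_d(t)| + 30 √t · τ(d)⁴ (Σ_{g² ∣ d} g)/d`
  have hdec : ∀ d ∈ (Icc 1 ⌊D⌋₊).filter IsCubefree, |fiSieveSeq.remainder d t| ≤
      |fiSieveSeq.congrSum d t - fiMainTerm d t| + 30 * Real.sqrt t *
        ((#d.divisors : ℝ) ^ 4 * (∑ g ∈ d.divisors with g ^ 2 ∣ d, (g : ℝ)) / d) := by
    intro d hd
    obtain ⟨hd1, hcf⟩ := mem_filter.mp hd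
    have hd0 : d ≠ 0 := by have := (mem_Icc.mp hd1).1; omega
    have hdpos : (0 : ℝ) < d := by exact_mod_cast Nat.pos_of_ne_zero hd0
    have hM := abs_fiMainTerm_sub_le hd0 hcf ht
    have hA := abs_fiCount_sub_le ht
    have hν := fiNu_eq_fiDensity_mul_sq hcf hd0
    have hg0 : 0 ≤ fiDensity d := by
      have h2 : 0 * ((d : ℝ) ^ 2) ≤ fiDensity d * (d : ℝ) ^ 2 := by
        rw [zero_mul, ← hν]; exact Nat.cast_nonneg _
      exact le_of_mul_le_mul_right h2 (by positivity)
    have hgle := fiDensity_le_of_isCubefree hd0 hcf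
    have hτ1 : (1 : ℝ) ≤ #d.divisors := by exact_mod_cast one_le_card_divisors hd0
    have hS0 : (0 : ℝ) ≤ ∑ g ∈ d.divisors with g ^ 2 ∣ d, (g : ℝ) :=
      sum_nonneg fun _ _ => Nat.cast_nonneg _
    -- `τ² S/d ≤ τ⁴ S/d`
    have hgle' : fiDensity d ≤ (#d.divisors : ℝ) ^ 4 * (∑ g ∈ d.divisors with g ^ 2 ∣ d, (g : ℝ)) / d := by
      refine hgle.trans ?_
      rw [div_le_div_iff_of_pos_right hdpos]
      refine mul_le_mul_of_nonneg_right ?_ hS0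
      calc (#d.divisors : ℝ) ^ 2 = (#d.divisors : ℝ) ^ 2 * 1 := (mul_one _).symm
        _ ≤ (#d.divisors : ℝ) ^ 2 * (#d.divisors : ℝ) ^ 2 :=
            mul_le_mul_of_nonneg_left (one_le_pow₀ hτ1) (by positivity)
        _ = (#d.divisors : ℝ) ^ 4 := by ring
    rw [fiSieveSeq_remainder]
    have heq : fiSieveSeq.congrSum d t - fiDensity d * fiCount t =
        (fiSieveSeq.congrSum d t - fiMainTerm d t) +
          (fiMainTerm d t - 4 * friedlanderIwaniecKappa * fiDensity d * t ^ (3 / 4 : ℝ)) -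
          fiDensity d * (fiCount t - 4 * friedlanderIwaniecKappa * t ^ (3 / 4 : ℝ)) := by ring
    rw [heq]
    have e1 := abs_sub ((fiSieveSeq.congrSum d t - fiMainTerm d t) +
        (fiMainTerm d t - 4 * friedlanderIwaniecKappa * fiDensity d * t ^ (3 / 4 : ℝ)))
      (fiDensity d * (fiCount t - 4 * friedlanderIwaniecKappa * t ^ (3 / 4 : ℝ)))
    have e2 := abs_add_le (fiSieveSeq.congrSum d t - fiMainTerm d t)
      (fiMainTerm d t - 4 * friedlanderIwaniecKappa * fiDensity d * t ^ (3 / 4 : ℝ))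
    have e3 : |fiDensity d * (fiCount t - 4 * friedlanderIwaniecKappa * t ^ (3 / 4 : ℝ))| ≤
        (#d.divisors : ℝ) ^ 4 * (∑ g ∈ d.divisors with g ^ 2 ∣ d, (g : ℝ)) / d * (14 * Real.sqrt t) := by
      rw [abs_mul, abs_of_nonneg hg0]
      exact mul_le_mul hgle' hA (abs_nonneg _) (by positivity)
    have e4 : 16 * (#d.divisors : ℝ) ^ 4 * (∑ g ∈ d.divisors with g ^ 2 ∣ d, (g : ℝ)) * Real.sqrt t / d =
        16 * Real.sqrt t * ((#d.divisors : ℝ) ^ 4 * (∑ g ∈ d.divisors with g ^ 2 ∣ d, (g : ℝ)) / d) := by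
      ring
    rw [e4] at hM
    linarith [e1, e2, e3, hM]
  -- the three sums
  have hsum1 : ∑ d ∈ (Icc 1 ⌊D⌋₊).filter IsCubefree, |fiSieveSeq.congrSum d t - fiMainTerm d t| ≤
      max K₁ 0 * D ^ (1 / 4 : ℝ) * x ^ (9 / 16 + ε : ℝ) := by
    calc ∑ d ∈ (Icc 1 ⌊D⌋₊).filter IsCubefree, |fiSieveSeq.congrSum d t - fiMainTerm d t|
        ≤ ∑ d ∈ Icc 1 ⌊D⌋₊, |fiSieveSeq.congrSum d t - fiMainTerm d t| :=
          sum_le_sum_of_subset_of_nonneg (filter_subset _ _) fun _ _ _ => abs_nonneg _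
      _ ≤ K₁ * D ^ (1 / 4 : ℝ) * t ^ (9 / 16 + ε : ℝ) := hK₁ t ht D hD
      _ ≤ max K₁ 0 * D ^ (1 / 4 : ℝ) * t ^ (9 / 16 + ε : ℝ) := by
          gcongr
          exact le_max_left _ _
      _ ≤ max K₁ 0 * D ^ (1 / 4 : ℝ) * x ^ (9 / 16 + ε : ℝ) := by gcongr
  have hsqrt : Real.sqrt t ≤ x ^ (9 / 16 + ε : ℝ) := by
    calc Real.sqrt t ≤ Real.sqrt x := Real.sqrt_le_sqrt htx
      _ = x ^ (1 / 2 : ℝ) := Real.sqrt_eq_rpow x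
      _ ≤ x ^ (9 / 16 + ε : ℝ) := Real.rpow_le_rpow_of_exponent_le hx (by linarith)
  have hfloor : ((⌊D⌋₊ : ℕ) : ℝ) ^ (1 / 8 : ℝ) ≤ D ^ (1 / 4 : ℝ) := by
    calc ((⌊D⌋₊ : ℕ) : ℝ) ^ (1 / 8 : ℝ) ≤ D ^ (1 / 8 : ℝ) :=
          Real.rpow_le_rpow (Nat.cast_nonneg _) (Nat.floor_le hD0.le) (by norm_num)
      _ ≤ D ^ (1 / 4 : ℝ) := Real.rpow_le_rpow_of_exponent_le hD (by norm_num)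
  have hsum2 : ∑ d ∈ (Icc 1 ⌊D⌋₊).filter IsCubefree,
      (#d.divisors : ℝ) ^ 4 * (∑ g ∈ d.divisors with g ^ 2 ∣ d, (g : ℝ)) / d ≤ C * D ^ (1 / 4 : ℝ) := by
    calc ∑ d ∈ (Icc 1 ⌊D⌋₊).filter IsCubefree,
          (#d.divisors : ℝ) ^ 4 * (∑ g ∈ d.divisors with g ^ 2 ∣ d, (g : ℝ)) / d
        ≤ ∑ d ∈ Icc 1 ⌊D⌋₊, (#d.divisors : ℝ) ^ 4 * (∑ g ∈ d.divisors with g ^ 2 ∣ d, (g : ℝ)) / d :=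
          sum_le_sum_of_subset_of_nonneg (filter_subset _ _) fun d _ _ => by positivity
      _ ≤ C * ((⌊D⌋₊ : ℕ) : ℝ) ^ (1 / 8 : ℝ) := hC ⌊D⌋₊
      _ ≤ C * D ^ (1 / 4 : ℝ) := by gcongr
  have hS2 : 0 ≤ ∑ d ∈ (Icc 1 ⌊D⌋₊).filter IsCubefree,
      (#d.divisors : ℝ) ^ 4 * (∑ g ∈ d.divisors with g ^ 2 ∣ d, (g : ℝ)) / d :=
    sum_nonneg fun d _ => by positivity
  calc ∑ d ∈ (Icc 1 ⌊D⌋₊).filter IsCubefree, |fiSieveSeq.remainder d t|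
      ≤ ∑ d ∈ (Icc 1 ⌊D⌋₊).filter IsCubefree, (|fiSieveSeq.congrSum d t - fiMainTerm d t| +
          30 * Real.sqrt t * ((#d.divisors : ℝ) ^ 4 * (∑ g ∈ d.divisors with g ^ 2 ∣ d, (g : ℝ)) / d)) :=
        sum_le_sum hdec
    _ = ∑ d ∈ (Icc 1 ⌊D⌋₊).filter IsCubefree, |fiSieveSeq.congrSum d t - fiMainTerm d t| +
          30 * Real.sqrt t * ∑ d ∈ (Icc 1 ⌊D⌋₊).filter IsCubefree,
            (#d.divisors : ℝ) ^ 4 * (∑ g ∈ d.divisors with g ^ 2 ∣ d, (g : ℝ)) / d := by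
        rw [sum_add_distrib, mul_sum]
    _ ≤ max K₁ 0 * D ^ (1 / 4 : ℝ) * x ^ (9 / 16 + ε : ℝ) +
          30 * x ^ (9 / 16 + ε : ℝ) * (C * D ^ (1 / 4 : ℝ)) := by
        have := Real.sqrt_nonneg t
        gcongr
    _ = (max K₁ 0 + 30 * C) * D ^ (1 / 4 : ℝ) * x ^ (9 / 16 + ε : ℝ) := by ring


/-! ### parity.S17 from Proposition 2.1, Lemma 3.1, Proposition 4.1 and Siegel–Walfisz -/

/-- **(4.7)–(4.8) for `a_n`** from FI Proposition 2.1, Lemma 3.1, Proposition 4.1 (named facts, as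
printed) and Siegel–Walfisz (parity.S28). [cite: FriedlanderIwaniecAnnals1998, §4, (4.7)-(4.8)] -/
theorem FriedlanderIwaniec1998_primeSum_asymp_of_lemma31_inputs_of_siegelWalfisz
    (h21 : FriedlanderIwaniec1998_prop21) (h31 : FriedlanderIwaniec1998_lemma31)
    (h41 : FriedlanderIwaniec1998_prop41) (hSW : siegel_walfisz) :
    FriedlanderIwaniec1998_primeSum_asymp :=
  FriedlanderIwaniec1998_primeSum_asymp_of_sq_inputs_of_siegelWalfisz h21
    (FriedlanderIwaniec1998_prop35_of_lemma31 h31) h41 hSW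

/-- **Friedlander–Iwaniec Theorem 1 (parity.S17, quantitative form)** from FI Proposition 2.1,
Lemma 3.1, Proposition 4.1 (named facts, as printed) and Siegel–Walfisz (parity.S28).
[cite: FriedlanderIwaniecAnnals1998, Theorem 1 via §§3-4] -/
theorem friedlanderIwaniecSum_isEquivalent_of_lemma31_inputs_of_siegelWalfisz
    (h21 : FriedlanderIwaniec1998_prop21) (h31 : FriedlanderIwaniec1998_lemma31)
    (h41 : FriedlanderIwaniec1998_prop41) (hSW : siegel_walfisz) :
    friedlanderIwaniecSum_isEquivalent :=
  friedlanderIwaniecSum_isEquivalent_of_sq_inputs_of_siegelWalfisz h21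
    (FriedlanderIwaniec1998_prop35_of_lemma31 h31) h41 hSW

/-- **parity.S17, qualitative clause** (infinitely many primes `p = a² + b⁴`) from FI
Proposition 2.1, Lemma 3.1, Proposition 4.1 (named facts, as printed) and Siegel–Walfisz
(parity.S28). [cite: FriedlanderIwaniecAnnals1998, Theorem 1] -/
theorem setOf_prime_sq_add_pow_four_infinite_of_lemma31_inputs_of_siegelWalfisz
    (h21 : FriedlanderIwaniec1998_prop21) (h31 : FriedlanderIwaniec1998_lemma31)
    (h41 : FriedlanderIwaniec1998_prop41) (hSW : siegel_walfisz) :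
    setOf_prime_sq_add_pow_four_infinite :=
  setOf_prime_sq_add_pow_four_infinite_of_sq_inputs_of_siegelWalfisz h21
    (FriedlanderIwaniec1998_prop35_of_lemma31 h31) h41 hSW

/-- The same through the parallel route of `FriedlanderIwaniecPrimesProp21` (Proposition 2.1 with
(2.8) in its consumed form): parity.S17 from `FriedlanderIwaniec1998_prop21_consumed`, Lemma 3.1,
Proposition 4.1 and Siegel–Walfisz. [cite: FriedlanderIwaniecAnnals1998, Theorem 1 via §§2-4] -/
theorem friedlanderIwaniecSum_isEquivalent_of_consumedInputs_of_lemma31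
    (h21 : FriedlanderIwaniec1998_prop21_consumed) (h31 : FriedlanderIwaniec1998_lemma31)
    (h41 : FriedlanderIwaniec1998_prop41) (hSW : siegel_walfisz) :
    friedlanderIwaniecSum_isEquivalent :=
  friedlanderIwaniecSum_isEquivalent_of_consumedInputs h21
    (FriedlanderIwaniec1998_prop35_of_lemma31 h31) h41
    (FriedlanderIwaniec1998_hyp27_of_siegelWalfisz hSW)

/-- parity.S17, qualitative clause, through the consumed-(2.8) route.
[cite: FriedlanderIwaniecAnnals1998, Theorem 1] -/
theorem setOf_prime_sq_add_pow_four_infinite_of_consumedInputs_of_lemma31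
    (h21 : FriedlanderIwaniec1998_prop21_consumed) (h31 : FriedlanderIwaniec1998_lemma31)
    (h41 : FriedlanderIwaniec1998_prop41) (hSW : siegel_walfisz) :
    setOf_prime_sq_add_pow_four_infinite :=
  setOf_prime_sq_add_pow_four_infinite_of_isEquivalent
    (friedlanderIwaniecSum_isEquivalent_of_consumedInputs_of_lemma31 h21 h31 h41 hSW)

end Literature.NumberTheory.Sieve
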